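import Literature.MathematicalPhysics.QuantumLattice.HubbardWave0RepulsiveProofs
import Literature.MathematicalPhysics.QuantumLattice.HubbardModelParticleHoleProofs
import Literature.MathematicalPhysics.QuantumLattice.NagaokaTasaki
import HarnessLib

/-!
# Flat-band ferromagnetism (Tasaki 1992; Mielke–Tasaki): the cell construction, every `U > 0`

Topic `MathematicalPhysics/QuantumLattice` (Hubbard family; rigorous ferromagnetism). We formalise
H. Tasaki's flat-band ferromagnetism theorem in the generality of the review
[Tasaki 1998, §6.1, Theorem 6.1] (= Tasaki, PRL **69** (1992) 1608, Theorem):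

**Model (cell construction, [Tasaki 1998, §6.1, eqs. (6.1)–(6.4)]).** The lattice `Λ` is split into
EXTERNAL sites `E ⊆ Λ` and INTERNAL sites `i ∉ E`; every internal site `i` carries a cell
`cell i ⊆ E` (its external sites). With `λ^{(i)} = λ δ_i + Σ_{y ∈ cell i} δ_y` the hopping matrix is
`t_{xy} = t Σ_{i ∉ E} λ^{(i)}_x λ^{(i)}_y` (`t > 0`, `λ ≠ 0`; this includes the on-site potentials
`t_{ii} = tλ²`, `t_{yy} = t · #{cells ∋ y}`, cf. the example (6.5) of §6.2), and the Hubbard Hamiltonian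
is, in Tasaki's sign convention `H_hop = + Σ t_{xy} c†_{xσ} c_{yσ}` (§2.4),
`H = Σ_{x,y,σ} t_{xy} c†_{xσ} c_{yσ} + U Σ_x n_{x↑} n_{x↓}` on the fermionic Fock space of the tree
(`HubbardWave0`: `Fock (Orb Λ)`, `creation`, `annihilation`, `numberOp`, `groundEnergy`,
`IsGroundState`, `spinSq`).

**Theorem [Tasaki 1998, Theorem 6.1] (`flatBand_ferromagnetism`).** Let `t > 0`, `λ ≠ 0`, `U > 0`,
electron number `N_e = |E|`, and assume the external sites are connected through the cells
(`(cellGraph E cell).Preconnected`: Tasaki's "the whole lattice is connected via nonvanishing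
`t_{xy}`"). Then the ground-state energy in the `N_e`-particle sector is `0`, every ground state has
total spin `S = S_max = N_e/2` (`S² ψ = S_max(S_max+1) ψ`), and the ground states are non-degenerate
apart from the trivial `(2 S_max + 1)`-fold degeneracy: the ground eigenspace of the `N_e`-sector has
dimension exactly `N_e + 1`.

## The printed proof and its transcription

[Tasaki 1998, §5.1 and §6.4]. (1) `H_hop = t Σ_i Σ_σ C†_σ(λ^{(i)}) C_σ(λ^{(i)}) ≥ 0`
(`hoppingOp_cellHopping_eq`, the matrix `(t_{xy})` is a positive combination of rank-one
projections) and `H_int ≥ 0`; the fully polarised state `Ψ↑ = Π_{y ∈ E} b†_{y↑} |0⟩`,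
`b†_{yσ} = C†_σ(φ^{(y)})`, `φ^{(y)} = λ δ_y - Σ_{i : y ∈ cell i} δ_i` (eq. (6.6)), has
`H_hop Ψ↑ = 0` because `⟨λ^{(i)}, φ^{(y)}⟩ = 0` (eq. (6.7)) and `H_int Ψ↑ = 0`, and `Ψ↑ ≠ 0`; hence
`E₀ = 0` and the ground states are exactly the `N_e`-particle `Φ ≠ 0` with
`C_σ(λ^{(i)}) Φ = 0` for all `i, σ` and `c_{x↓} c_{x↑} Φ = 0` for all `x` (§5.1, §5.3).
(2) DEVIATION IN BOOKKEEPING (same mathematics): Tasaki expands `Φ` in the non-orthogonal Slater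
basis `Π b†_{y,σ_y}|0⟩` (§6.4, via his Lemma 2.3) with coefficients `g[σ̃]`; we read `g[σ̃]`
directly as the AMPLITUDE of `Φ` on the occupation configuration in which every external site `y`
carries one electron of spin `σ_y` and every internal site is empty (`extConfig`), using the kernel
conditions `C_σ(λ^{(i)})Φ = 0` to show that these amplitudes determine `Φ`
(`eq_zero_of_forall_extConfig`, elimination of internal orbitals) — this replaces Lemma 2.3.
(3) The no-double-occupancy condition at an INTERNAL site `i` gives, exactly as in the derivation of
the display for `c_{x↓}c_{x↑}Φ` in §6.4, `(Σ_{y ∈ cell i} c_{y↑})(Σ_{z ∈ cell i} c_{z↓}) Φ = 0`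
(`cellAnn_mul_cellAnn_mulVec_eq_zero`), whose amplitude form is the EXCHANGE RELATION
`g[σ̃] = g[σ̃_{y↔z}]` for `y, z` in a common cell (`extAmp_exchange`; the fermion sign is `+1` as
printed). (4) Connectivity of `E` through the cells makes `g` constant on every `S^z` sector
(`extAmp_const_of_card_eq`, token sliding `reflTransGen_isHop` of `HubbardLiebConfig`), so each
`S^z` sector of the ground space is at most one-dimensional; the `su(2)` lowering string
`(S⁻)^k Ψ↑`, `k = 0, …, N_e` (`Su2Multiplet`) fills them, which gives `S = N_e/2` and the dimension
`N_e + 1` — "the lowest energy state is unique in each sector with a fixed `S^z_tot`. This completes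
the proof."

Scope (faithful to the print): finite lattice, `N_e = |E|` exactly, any `U > 0`; nothing is claimed
at other fillings or for perturbed (non-flat) bands ([Tasaki 1998, §6.6, Theorem 6.3] is a different,
harder theorem). Mielke's line-graph version [Tasaki 1998, Theorem 6.2] is not formalised here.

## References

* H. Tasaki, *From Nagaoka's ferromagnetism to flat-band ferromagnetism and beyond*, Prog. Theor.
  Phys. **99** (1998) 489–548 = arXiv:cond-mat/9712219, §5.1, §6.1–§6.4, Theorem 6.1.
  [Tasaki1998PTP] (held text `paper:arxiv-cond-mat_9712219`, pp. 18–21 read).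
* H. Tasaki, *Ferromagnetism in the Hubbard models with degenerate single-electron ground states*,
  Phys. Rev. Lett. **69** (1992) 1608–1611. [Tasaki1992]
* A. Mielke, H. Tasaki, *Ferromagnetism in the Hubbard model. Examples from models with degenerate
  single-electron ground states*, Commun. Math. Phys. **158** (1993) 341–371. [MielkeTasaki1993]
-/

noncomputable section

open Matrix Finset
open scoped ComplexOrder

namespace Literature.MathematicalPhysics.QuantumLattice

namespace FlatBand

variable {Λ : Type*} [LinearOrder Λ] [Fintype Λ]

/-! ### The model -/

/-- Spin-independent hopping with a real hopping matrix `T` in Tasaki's sign convention,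
`B(T) = Σ_{x,y,σ} T_{xy} c†_{xσ} c_{yσ}` (diagonal entries = on-site potentials).
[cite: Tasaki1998PTP, §2.4 (`H_hop = B(T) = Σ_{x,y,σ} t_{xy} c†_{xσ} c_{yσ}`)] -/
def hoppingOp (T : Λ → Λ → ℝ) : Matrix (Finset (Orb Λ)) (Finset (Orb Λ)) ℂ :=
  ∑ x, ∑ y, ∑ σ : Fin 2, (T x y : ℂ) • (creation (orb x σ) * annihilation (orb y σ))

/-- The smeared annihilation operator `C_σ(v) = Σ_x v_x c_{xσ}` of a real one-particle vector `v`.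
[cite: Tasaki1998PTP, §2.3 (definition of `C_σ(φ)`)] -/
def fieldAnn (v : Λ → ℝ) (σ : Fin 2) : Matrix (Finset (Orb Λ)) (Finset (Orb Λ)) ℂ :=
  ∑ x, (v x : ℂ) • annihilation (orb x σ)

/-- The smeared creation operator `C†_σ(v) = Σ_x v_x c†_{xσ}` of a real one-particle vector `v`.
[cite: Tasaki1998PTP, §2.3 (definition of `C†_σ(φ)`)] -/
def fieldCre (v : Λ → ℝ) (σ : Fin 2) : Matrix (Finset (Orb Λ)) (Finset (Orb Λ)) ℂ :=
  ∑ x, (v x : ℂ) • creation (orb x σ)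

/-- Tasaki's cell vector `λ^{(i)} = λ δ_i + Σ_{y ∈ cell i} δ_y` of the internal site `i`.
[cite: Tasaki1998PTP, §6.1, eq. (6.3) (definition of `λ^{(j)}`)] -/
def cellVec (cell : Λ → Finset Λ) (lam : ℝ) (i : Λ) : Λ → ℝ :=
  fun x => if x = i then lam else if x ∈ cell i then 1 else 0

/-- The hopping matrix of the cell construction, `t_{xy} = t Σ_{i ∉ E} λ^{(i)}_x λ^{(i)}_y`.
[cite: Tasaki1998PTP, §6.1, eqs. (6.2)–(6.4) (`t^{(j)}_{xy} = t λ^{(j)}_x λ^{(j)}_y`, `t_{xy} = Σ_j t^{(j)}_{xy}`)] -/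
def cellHopping (E : Finset Λ) (cell : Λ → Finset Λ) (t lam : ℝ) : Λ → Λ → ℝ :=
  fun x y => t * ∑ i ∈ Eᶜ, cellVec cell lam i x * cellVec cell lam i y

/-- The on-site repulsion `Σ_x n_{x↑} n_{x↓}`. [cite: Tasaki1998PTP, §2.5 (`H_int = U Σ_x n_{x↑} n_{x↓}`)] -/
def onSiteRepulsion : Matrix (Finset (Orb Λ)) (Finset (Orb Λ)) ℂ :=
  ∑ x : Λ, numberOp x 0 * numberOp x 1

/-- The Hubbard Hamiltonian of the cell construction,
`H = Σ_{x,y,σ} t_{xy} c†_{xσ} c_{yσ} + U Σ_x n_{x↑} n_{x↓}`. [cite: Tasaki1998PTP, §2.6 and §6.1] -/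
def hamiltonian (E : Finset Λ) (cell : Λ → Finset Λ) (t lam U : ℝ) :
    Matrix (Finset (Orb Λ)) (Finset (Orb Λ)) ℂ :=
  hoppingOp (cellHopping E cell t lam) + (U : ℂ) • onSiteRepulsion

/-- The cell graph on the external sites: `y ∼ z` iff `y ≠ z` lie in a common cell. Tasaki's
connectivity hypothesis ("the whole lattice is connected via nonvanishing `t_{xy}`") is that this
graph is connected. [cite: Tasaki1998PTP, §6.1] -/
def cellGraph (E : Finset Λ) (cell : Λ → Finset Λ) : SimpleGraph ↥E :=
  SimpleGraph.fromRel fun y z => ∃ i, i ∉ E ∧ (y : Λ) ∈ cell i ∧ (z : Λ) ∈ cell i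

/-! ### Field operators: anticommutators and kernels -/

section Fields

omit [Fintype Λ] in
/-- Unfolding `cellVec` at the internal site. [cite: Tasaki1998PTP, §6.1, eq. (6.3)] -/
theorem cellVec_self (cell : Λ → Finset Λ) (lam : ℝ) (i : Λ) : cellVec cell lam i i = lam := by
  simp [cellVec]

omit [Fintype Λ] in
/-- Unfolding `cellVec` off the internal site. [cite: Tasaki1998PTP, §6.1, eq. (6.3)] -/
theorem cellVec_of_ne (cell : Λ → Finset Λ) (lam : ℝ) {i x : Λ} (h : x ≠ i) :
    cellVec cell lam i x = if x ∈ cell i then 1 else 0 := by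
  simp [cellVec, h]

/-- `C†_σ(v) = C_σ(v)ᴴ` for real `v`. [cite: Tasaki1998PTP, §2.3 (definition of `C_σ(φ)`, `C†_σ(φ)`)] -/
theorem fieldCre_eq_conjTranspose (v : Λ → ℝ) (σ : Fin 2) :
    fieldCre v σ = (fieldAnn v σ)ᴴ := by
  rw [fieldAnn, fieldCre, conjTranspose_sum]
  refine sum_congr rfl fun x _ => ?_
  rw [conjTranspose_smul, creation, Complex.star_def, Complex.conj_ofReal]

/-- The action of `C_σ(v)` on a wave function:
`(C_σ(v) ψ)(s) = Σ_x v_x [xσ ∉ s] jwSign · ψ(s ∪ {xσ})`. [cite: Tasaki1998PTP, §2.3 (definition of `C_σ(φ)`) with Appendix "Explicit construction of the Hilbert space and fermion operators"] -/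
theorem fieldAnn_mulVec_apply (v : Λ → ℝ) (σ : Fin 2) (ψ : Fock (Orb Λ)) (s : Finset (Orb Λ)) :
    (fieldAnn v σ *ᵥ ψ) s =
      ∑ x, if orb x σ ∉ s then (v x : ℂ) * (jwSign (orb x σ) s * ψ (insert (orb x σ) s)) else 0 := by
  rw [fieldAnn, sum_mulVec, Finset.sum_apply]
  refine sum_congr rfl fun x _ => ?_
  rw [smul_mulVec, Pi.smul_apply, smul_eq_mul, annihilation_mulVec_apply]
  split_ifs <;> simp

/-- `{C_σ(v), c†_{yτ}} = δ_{στ} v_y`. [cite: Tasaki1998PTP, §2.3 (generalized canonical anticommutation relations for `C_σ(φ)`, `C†_σ(φ)`)] -/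
theorem fieldAnn_mul_creation_add (v : Λ → ℝ) (σ τ : Fin 2) (y : Λ) :
    fieldAnn v σ * creation (orb y τ) + creation (orb y τ) * fieldAnn v σ =
      if σ = τ then (v y : ℂ) • (1 : Matrix (Finset (Orb Λ)) (Finset (Orb Λ)) ℂ) else 0 := by
  rw [fieldAnn, sum_mul, mul_sum, ← sum_add_distrib]
  have hx : ∀ x, (v x : ℂ) • annihilation (orb x σ) * creation (orb y τ) +
      creation (orb y τ) * ((v x : ℂ) • annihilation (orb x σ)) =
        if x = y ∧ σ = τ then (v x : ℂ) • (1 : Matrix (Finset (Orb Λ)) (Finset (Orb Λ)) ℂ) else 0 := by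
    intro x
    rw [smul_mul_assoc, mul_smul_comm, ← smul_add,
      annihilation_mul_creation_add_creation_mul_annihilation_holds]
    by_cases h : x = y ∧ σ = τ
    · rw [if_pos h, if_pos (orb_inj.2 h)]
    · rw [if_neg h, if_neg (fun h' => h (orb_inj.1 h')), smul_zero]
  simp_rw [hx]
  by_cases hστ : σ = τ
  · subst hστ
    rw [if_pos rfl, Finset.sum_eq_single y]
    · rw [if_pos ⟨rfl, rfl⟩]
    · intro x _ hx
      rw [if_neg (fun h => hx h.1)]
    · intro h; exact absurd (mem_univ y) h
  · rw [if_neg hστ]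
    refine sum_eq_zero fun x _ => ?_
    rw [if_neg (fun h => hστ h.2)]

/-- `{C_σ(v), C†_τ(w)} = δ_{στ} ⟨v, w⟩`. [cite: Tasaki1998PTP, §2.3 (generalized canonical anticommutation relations for `C_σ(φ)`, `C†_σ(φ)`)] -/
theorem fieldAnn_mul_fieldCre_add (v w : Λ → ℝ) (σ τ : Fin 2) :
    fieldAnn v σ * fieldCre w τ + fieldCre w τ * fieldAnn v σ =
      if σ = τ then ((∑ y, v y * w y : ℝ) : ℂ) • (1 : Matrix (Finset (Orb Λ)) (Finset (Orb Λ)) ℂ)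
      else 0 := by
  rw [fieldCre, mul_sum, sum_mul, ← sum_add_distrib]
  simp_rw [mul_smul_comm, smul_mul_assoc, ← smul_add, fieldAnn_mul_creation_add]
  by_cases hστ : σ = τ
  · subst hστ
    simp only [if_true, smul_smul, ← Finset.sum_smul]
    congr 1
    push_cast
    exact sum_congr rfl fun y _ => mul_comm _ _
  · simp [hστ]

/-- `C_σ(v) c†_{yτ} = -c†_{yτ} C_σ(v)` for `σ ≠ τ`. [cite: Tasaki1998PTP, §2.3 (generalized canonical anticommutation relations for `C_σ(φ)`, `C†_σ(φ)`)] -/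
theorem fieldAnn_mul_creation_of_ne (v : Λ → ℝ) {σ τ : Fin 2} (h : σ ≠ τ) (y : Λ) :
    fieldAnn v σ * creation (orb y τ) = -(creation (orb y τ) * fieldAnn v σ) := by
  have := fieldAnn_mul_creation_add v σ τ y
  rw [if_neg h] at this
  exact eq_neg_of_add_eq_zero_left this

/-- `C_σ(v)` and `c_{yτ}` anticommute. [cite: Tasaki1998PTP, §2.3 (generalized canonical anticommutation relations for `C_σ(φ)`, `C†_σ(φ)`)] -/
theorem fieldAnn_mul_annihilation (v : Λ → ℝ) (σ τ : Fin 2) (y : Λ) :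
    fieldAnn v σ * annihilation (orb y τ) = -(annihilation (orb y τ) * fieldAnn v σ) := by
  rw [fieldAnn, sum_mul, mul_sum, ← sum_neg_distrib]
  refine sum_congr rfl fun x _ => ?_
  rw [smul_mul_assoc, mul_smul_comm, LiebThm1.annihilation_mul_annihilation_eq_neg, smul_neg]

/-- `C_σ(v)` kills the vacuum. [cite: Tasaki1998PTP, §2.3 (`C_σ(φ) Φ_vac = 0`, used in the proof of Lemma 2.1)] -/
theorem fieldAnn_mulVec_vacuum (v : Λ → ℝ) (σ : Fin 2) :
    fieldAnn v σ *ᵥ (vacuum : Fock (Orb Λ)) = 0 := by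
  rw [fieldAnn, sum_mulVec]
  refine sum_eq_zero fun x _ => ?_
  rw [smul_mulVec, annihilation_mulVec_vacuum_holds, smul_zero]

/-- `C†_σ(v) C_σ(v) = Σ_{x,y} v_x v_y c†_{xσ} c_{yσ}`. [cite: Tasaki1998PTP, §5.1] -/
theorem fieldCre_mul_fieldAnn (v : Λ → ℝ) (σ : Fin 2) :
    fieldCre v σ * fieldAnn v σ =
      ∑ x, ∑ y, ((v x * v y : ℝ) : ℂ) • (creation (orb x σ) * annihilation (orb y σ)) := by
  rw [fieldCre, fieldAnn, sum_mul]
  refine sum_congr rfl fun x _ => ?_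
  rw [mul_sum]
  refine sum_congr rfl fun y _ => ?_
  rw [smul_mul_assoc, mul_smul_comm, smul_smul, Complex.ofReal_mul]

/-- **`H_hop ≥ 0` structure: the cell hopping term is a sum of squares**,
`B(t_{··}) = t Σ_{i ∉ E} Σ_σ C†_σ(λ^{(i)}) C_σ(λ^{(i)})`. [cite: Tasaki1998PTP, §6.3 ("`T ≥ 0` … sum of
positive semidefinite matrices") and §5.1] -/
theorem hoppingOp_cellHopping_eq (E : Finset Λ) (cell : Λ → Finset Λ) (t lam : ℝ) :
    hoppingOp (cellHopping E cell t lam) =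
      (t : ℂ) • ∑ i ∈ Eᶜ, ∑ σ : Fin 2,
        fieldCre (cellVec cell lam i) σ * fieldAnn (cellVec cell lam i) σ := by
  simp_rw [fieldCre_mul_fieldAnn, hoppingOp, cellHopping]
  rw [Finset.smul_sum]
  -- reorder the sums: `Σ_x Σ_y Σ_σ (t Σ_i λλ) • O = t • Σ_i Σ_σ Σ_x Σ_y (λλ) • O`
  have : ∀ x y (σ : Fin 2),
      ((t * ∑ i ∈ Eᶜ, cellVec cell lam i x * cellVec cell lam i y : ℝ) : ℂ) •
          (creation (orb x σ) * annihilation (orb y σ) : Matrix (Finset (Orb Λ)) (Finset (Orb Λ)) ℂ) =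
        (t : ℂ) • ∑ i ∈ Eᶜ, ((cellVec cell lam i x * cellVec cell lam i y : ℝ) : ℂ) •
          (creation (orb x σ) * annihilation (orb y σ)) := by
    intro x y σ
    rw [Complex.ofReal_mul, Complex.ofReal_sum, ← smul_smul, Finset.sum_smul]
  simp_rw [this, ← Finset.smul_sum]
  congr 1
  -- now `Σ_x Σ_y Σ_σ Σ_i f = Σ_i Σ_σ Σ_x Σ_y f`
  calc ∑ x, ∑ y, ∑ σ : Fin 2, ∑ i ∈ Eᶜ, ((cellVec cell lam i x * cellVec cell lam i y : ℝ) : ℂ) •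
          (creation (orb x σ) * annihilation (orb y σ) : Matrix (Finset (Orb Λ)) (Finset (Orb Λ)) ℂ)
      = ∑ x, ∑ y, ∑ i ∈ Eᶜ, ∑ σ : Fin 2, ((cellVec cell lam i x * cellVec cell lam i y : ℝ) : ℂ) •
          (creation (orb x σ) * annihilation (orb y σ)) := by
        refine sum_congr rfl fun x _ => sum_congr rfl fun y _ => ?_
        rw [Finset.sum_comm]
    _ = ∑ x, ∑ i ∈ Eᶜ, ∑ y, ∑ σ : Fin 2, ((cellVec cell lam i x * cellVec cell lam i y : ℝ) : ℂ) •
          (creation (orb x σ) * annihilation (orb y σ)) := by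
        refine sum_congr rfl fun x _ => ?_
        rw [Finset.sum_comm]
    _ = ∑ i ∈ Eᶜ, ∑ x, ∑ y, ∑ σ : Fin 2, ((cellVec cell lam i x * cellVec cell lam i y : ℝ) : ℂ) •
          (creation (orb x σ) * annihilation (orb y σ)) := by
        rw [Finset.sum_comm]
    _ = ∑ i ∈ Eᶜ, ∑ σ : Fin 2, ∑ x, ∑ y, ((cellVec cell lam i x * cellVec cell lam i y : ℝ) : ℂ) •
          (creation (orb x σ) * annihilation (orb y σ)) := by
        refine sum_congr rfl fun i _ => ?_
        calc ∑ x, ∑ y, ∑ σ : Fin 2, ((cellVec cell lam i x * cellVec cell lam i y : ℝ) : ℂ) •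
              (creation (orb x σ) * annihilation (orb y σ) : Matrix (Finset (Orb Λ)) (Finset (Orb Λ)) ℂ)
            = ∑ x, ∑ σ : Fin 2, ∑ y, ((cellVec cell lam i x * cellVec cell lam i y : ℝ) : ℂ) •
              (creation (orb x σ) * annihilation (orb y σ)) := by
              refine sum_congr rfl fun x _ => ?_; rw [Finset.sum_comm]
          _ = _ := by rw [Finset.sum_comm]

/-- The quadratic form of a square: `⟨ψ, C† C ψ⟩ = ‖Cψ‖²`. [cite: Tasaki1998PTP, Appendix "Positive semidefinite operators", proof of its third lemma (`⟨Φ, B†BΦ⟩ = ⟨BΦ, BΦ⟩ ≥ 0`)] -/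
theorem star_dotProduct_fieldCre_mul_fieldAnn_mulVec (v : Λ → ℝ) (σ : Fin 2) (ψ : Fock (Orb Λ)) :
    star ψ ⬝ᵥ ((fieldCre v σ * fieldAnn v σ) *ᵥ ψ) =
      star (fieldAnn v σ *ᵥ ψ) ⬝ᵥ (fieldAnn v σ *ᵥ ψ) := by
  rw [fieldCre_eq_conjTranspose]
  exact LiebThm1.star_dotProduct_conjTranspose_mul_mulVec _ ψ

/-- The on-site repulsion acts diagonally: it counts doubly occupied sites. [cite: Tasaki1998PTP, §2.5 (`H_int` and Figure (f:config): the interaction energy counts doubly occupied sites)] -/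
theorem onSiteRepulsion_mulVec_apply (ψ : Fock (Orb Λ)) (s : Finset (Orb Λ)) :
    (onSiteRepulsion *ᵥ ψ) s =
      ((univ.filter fun x : Λ => orb x 0 ∈ s ∧ orb x 1 ∈ s).card : ℂ) * ψ s := by
  rw [onSiteRepulsion, sum_mulVec, Finset.sum_apply]
  simp_rw [LiebTwo.numberOp_mul_numberOp_mulVec]
  rw [← Finset.sum_filter, sum_const, nsmul_eq_mul]

/-- `⟨ψ, Σ_x n_{x↑}n_{x↓} ψ⟩ = Σ_s (#doubly occupied sites of s) |ψ s|² ≥ 0`. [cite: Tasaki1998PTP, §2.5 and §5.1 ("`H_int ≥ 0` in general")] -/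
theorem star_dotProduct_onSiteRepulsion_mulVec (ψ : Fock (Orb Λ)) :
    star ψ ⬝ᵥ (onSiteRepulsion *ᵥ ψ) =
      ∑ s, ((univ.filter fun x : Λ => orb x 0 ∈ s ∧ orb x 1 ∈ s).card : ℂ) *
        (star (ψ s) * ψ s) := by
  rw [dotProduct]
  refine sum_congr rfl fun s _ => ?_
  rw [Pi.star_apply, onSiteRepulsion_mulVec_apply]
  ring

/-- Nonnegativity of `⟨ψ, Σ_x n_{x↑}n_{x↓} ψ⟩`. [cite: Tasaki1998PTP, §5.1 ("`H_int ≥ 0` in general")] -/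
theorem star_dotProduct_onSiteRepulsion_mulVec_nonneg (ψ : Fock (Orb Λ)) :
    0 ≤ star ψ ⬝ᵥ (onSiteRepulsion *ᵥ ψ) := by
  rw [star_dotProduct_onSiteRepulsion_mulVec]
  exact sum_nonneg fun s _ => mul_nonneg (by exact_mod_cast Nat.zero_le _) (star_mul_self_nonneg _)

end Fields

/-! ### `H ≥ 0`, the ground-state energy, and the kernel conditions -/

section Kernel

variable (E : Finset Λ) (cell : Λ → Finset Λ) (t lam U : ℝ)

/-- The quadratic form of `H`: `⟨ψ, Hψ⟩ = t Σ_{i,σ} ‖C_σ(λ^{(i)})ψ‖² + U ⟨ψ, Σ_x n_{x↑}n_{x↓} ψ⟩`.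
[cite: Tasaki1998PTP, §5.1] -/
theorem star_dotProduct_hamiltonian_mulVec (ψ : Fock (Orb Λ)) :
    star ψ ⬝ᵥ (hamiltonian E cell t lam U *ᵥ ψ) =
      (t : ℂ) * ∑ i ∈ Eᶜ, ∑ σ : Fin 2,
          star (fieldAnn (cellVec cell lam i) σ *ᵥ ψ) ⬝ᵥ (fieldAnn (cellVec cell lam i) σ *ᵥ ψ) +
        (U : ℂ) * (star ψ ⬝ᵥ (onSiteRepulsion *ᵥ ψ)) := by
  rw [hamiltonian, hoppingOp_cellHopping_eq, add_mulVec, dotProduct_add, smul_mulVec, dotProduct_smul,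
    smul_mulVec, dotProduct_smul, smul_eq_mul, smul_eq_mul, sum_mulVec, dotProduct_sum]
  congr 2
  refine sum_congr rfl fun i _ => ?_
  rw [sum_mulVec, dotProduct_sum]
  exact sum_congr rfl fun σ _ => star_dotProduct_fieldCre_mul_fieldAnn_mulVec _ σ ψ

variable {t U}

/-- **`H ≥ 0`**: for `t ≥ 0`, `U ≥ 0` the quadratic form of `H` is nonnegative.
[cite: Tasaki1998PTP, §5.1 ("`H = H_hop + H_int ≥ 0`")] -/
theorem star_dotProduct_hamiltonian_mulVec_nonneg (ht : 0 ≤ t) (hU : 0 ≤ U) (ψ : Fock (Orb Λ)) :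
    0 ≤ star ψ ⬝ᵥ (hamiltonian E cell t lam U *ᵥ ψ) := by
  rw [star_dotProduct_hamiltonian_mulVec]
  refine add_nonneg (mul_nonneg (by exact_mod_cast ht) (sum_nonneg fun i _ => sum_nonneg fun σ _ =>
    dotProduct_star_self_nonneg _)) (mul_nonneg (by exact_mod_cast hU)
    (star_dotProduct_onSiteRepulsion_mulVec_nonneg ψ))

/-- An `N`-particle unit vector exists whenever `N ≤ 2|Λ|` (a basis vector). [folklore] -/
private theorem exists_isNParticle_unit {N : ℕ} (hN : N ≤ Fintype.card (Orb Λ)) :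
    ∃ ψ : Fock (Orb Λ), IsNParticle N ψ ∧ star ψ ⬝ᵥ ψ = 1 := by
  classical
  obtain ⟨s, -, hs⟩ := Finset.exists_subset_card_eq (s := (univ : Finset (Orb Λ))) (n := N)
    (by rw [card_univ]; exact hN)
  refine ⟨Pi.single s 1, fun u hu => ?_, ?_⟩
  · rw [Pi.single_eq_of_ne]
    rintro rfl
    exact hu hs
  · simp [dotProduct, Pi.single_apply, apply_ite star]

/-- **`E₀ ≥ 0`** in every particle sector (`N ≤ 2|Λ|`), for `t, U ≥ 0`. [cite: Tasaki1998PTP, §5.1] -/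
theorem groundEnergy_hamiltonian_nonneg (ht : 0 ≤ t) (hU : 0 ≤ U) {N : ℕ} (hN : N ≤ Fintype.card (Orb Λ)) :
    0 ≤ groundEnergy (hamiltonian E cell t lam U) N := by
  unfold groundEnergy
  obtain ⟨ψ₀, hψ₀N, hψ₀1⟩ := exists_isNParticle_unit hN
  refine le_csInf ⟨_, ψ₀, hψ₀N, hψ₀1, rfl⟩ ?_
  rintro e ⟨ψ, -, -, rfl⟩
  exact (Complex.nonneg_iff.1 (star_dotProduct_hamiltonian_mulVec_nonneg E cell lam ht hU ψ)).1

/-- **`E₀ = 0`** as soon as the sector contains a nonzero zero-energy vector. [cite: Tasaki1998PTP, §5.1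
("there is a ferromagnetic state with energy zero … the ground state energy of `H` is 0")] -/
theorem groundEnergy_hamiltonian_eq_zero (ht : 0 ≤ t) (hU : 0 ≤ U) {N : ℕ} {φ : Fock (Orb Λ)}
    (hφN : IsNParticle N φ) (hφ0 : φ ≠ 0) (hφ : hamiltonian E cell t lam U *ᵥ φ = 0) :
    groundEnergy (hamiltonian E cell t lam U) N = 0 := by
  have hN : N ≤ Fintype.card (Orb Λ) := by
    obtain ⟨s, hs⟩ : ∃ s, φ s ≠ 0 := by
      by_contra h
      push Not at h
      exact hφ0 (funext h)
    have hcard : s.card = N := by by_contra h; exact hs (hφN s h)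
    rw [← hcard]
    exact s.card_le_univ
  refine le_antisymm ?_ (groundEnergy_hamiltonian_nonneg E cell lam ht hU hN)
  have h := LiebThm1.groundEnergy_mul_norm_le (hamiltonian E cell t lam U) hφN
  rw [expect, hφ, dotProduct_zero, Complex.zero_re] at h
  have hpos : 0 < (star φ ⬝ᵥ φ).re :=
    (Complex.pos_iff.1 (dotProduct_star_self_pos_iff.2 hφ0)).1
  exact nonpos_of_mul_nonpos_left h hpos

/-- **The kernel conditions.** For `t > 0`, `U > 0`: `Hψ = 0` iff `C_σ(λ^{(i)}) ψ = 0` for every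
internal `i` and spin `σ`, and `ψ` has no doubly occupied site. [cite: Tasaki1998PTP, §5.1 (the conditions `H_hop Φ = 0`, `H_int Φ = 0`,
`Σ_x n_{x↑}n_{x↓} Φ = 0` on a ground state) and Appendix "Positive semidefinite operators", last two lemmas] -/
theorem hamiltonian_mulVec_eq_zero_iff (ht : 0 < t) (hU : 0 < U) (ψ : Fock (Orb Λ)) :
    hamiltonian E cell t lam U *ᵥ ψ = 0 ↔
      (∀ i ∈ Eᶜ, ∀ σ : Fin 2, fieldAnn (cellVec cell lam i) σ *ᵥ ψ = 0) ∧ IsGutzwiller ψ := by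
  constructor
  · intro h
    have hq := star_dotProduct_hamiltonian_mulVec E cell t lam U ψ
    rw [h, dotProduct_zero] at hq
    have h1 : 0 ≤ (t : ℂ) * ∑ i ∈ Eᶜ, ∑ σ : Fin 2,
        star (fieldAnn (cellVec cell lam i) σ *ᵥ ψ) ⬝ᵥ (fieldAnn (cellVec cell lam i) σ *ᵥ ψ) :=
      mul_nonneg (by exact_mod_cast ht.le) (sum_nonneg fun i _ => sum_nonneg fun σ _ =>
        dotProduct_star_self_nonneg _)
    have h2 : 0 ≤ (U : ℂ) * (star ψ ⬝ᵥ (onSiteRepulsion *ᵥ ψ)) :=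
      mul_nonneg (by exact_mod_cast hU.le) (star_dotProduct_onSiteRepulsion_mulVec_nonneg ψ)
    obtain ⟨h1z, h2z⟩ := (add_eq_zero_iff_of_nonneg h1 h2).1 hq.symm
    constructor
    · intro i hi σ
      have ht0 : (t : ℂ) ≠ 0 := by exact_mod_cast ht.ne'
      have hs := (mul_eq_zero.1 h1z).resolve_left ht0
      rw [sum_eq_zero_iff_of_nonneg (fun i _ => sum_nonneg fun σ _ => dotProduct_star_self_nonneg _)] at hs
      have hs' := hs i hi
      rw [sum_eq_zero_iff_of_nonneg (fun σ _ => dotProduct_star_self_nonneg _)] at hs'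
      exact dotProduct_star_self_eq_zero.1 (hs' σ (mem_univ σ))
    · intro s hs
      have hU0 : (U : ℂ) ≠ 0 := by exact_mod_cast hU.ne'
      have hz := (mul_eq_zero.1 h2z).resolve_left hU0
      rw [star_dotProduct_onSiteRepulsion_mulVec, sum_eq_zero_iff_of_nonneg (fun s _ =>
        mul_nonneg (by exact_mod_cast Nat.zero_le _) (star_mul_self_nonneg _))] at hz
      have hzs := hz s (mem_univ s)
      obtain ⟨x, hx0, hx1⟩ := hs
      have hcard : 0 < (univ.filter fun x : Λ => orb x 0 ∈ s ∧ orb x 1 ∈ s).card :=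
        card_pos.2 ⟨x, by simp [hx0, hx1]⟩
      rcases mul_eq_zero.1 hzs with hc | hc
      · exact absurd (by exact_mod_cast hc : (univ.filter fun x : Λ => orb x 0 ∈ s ∧ orb x 1 ∈ s).card = 0)
          hcard.ne'
      · simpa using hc
  · rintro ⟨hK, hG⟩
    rw [hamiltonian, add_mulVec, hoppingOp_cellHopping_eq, smul_mulVec, sum_mulVec, smul_mulVec]
    have h1 : ∀ i ∈ Eᶜ, (∑ σ : Fin 2, fieldCre (cellVec cell lam i) σ * fieldAnn (cellVec cell lam i) σ) *ᵥ ψ = 0 := by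
      intro i hi
      rw [sum_mulVec]
      refine sum_eq_zero fun σ _ => ?_
      rw [← mulVec_mulVec, hK i hi σ, mulVec_zero]
    rw [sum_eq_zero h1, smul_zero, zero_add]
    have h2 : onSiteRepulsion *ᵥ ψ = 0 := by
      funext s
      rw [onSiteRepulsion_mulVec_apply, Pi.zero_apply]
      by_cases hs : HasDoubleOccupancy s
      · rw [hG s hs, mul_zero]
      · have : (univ.filter fun x : Λ => orb x 0 ∈ s ∧ orb x 1 ∈ s) = ∅ := by
          rw [Finset.filter_eq_empty_iff]
          intro x _ hx
          exact hs ⟨x, hx.1, hx.2⟩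
        rw [this, card_empty, Nat.cast_zero, zero_mul]
    rw [h2, smul_zero]

/-- With `E₀ = 0`, ground states are exactly the nonzero `N`-particle zero vectors of `H`.
[cite: Tasaki1998PTP, §5.1] -/
theorem isGroundState_iff_of_groundEnergy_eq_zero {N : ℕ}
    (h0 : groundEnergy (hamiltonian E cell t lam U) N = 0) (ψ : Fock (Orb Λ)) :
    IsGroundState (hamiltonian E cell t lam U) N ψ ↔
      IsNParticle N ψ ∧ ψ ≠ 0 ∧ hamiltonian E cell t lam U *ᵥ ψ = 0 := by
  rw [IsGroundState, h0, Complex.ofReal_zero, zero_smul]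

end Kernel

/-! ### External configurations and the elimination of internal orbitals -/

section Elimination

variable (E : Finset Λ) (cell : Λ → Finset Λ) (lam : ℝ)

/-- The annihilation operator of the cell of `i`, `F_{iσ} = Σ_{y ∈ cell i} c_{yσ}`.
[cite: Tasaki1998PTP, §6.4 (the sets `E_x` of external sites of the cell of an internal `x`)] -/
def cellAnn (i : Λ) (σ : Fin 2) : Matrix (Finset (Orb Λ)) (Finset (Orb Λ)) ℂ :=
  ∑ y ∈ cell i, annihilation (orb y σ)

/-- The configuration with every external site singly occupied — spin `↑` on `α ⊆ E`, spin `↓` on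
`E ∖ α` — and every internal site empty; its amplitude in a ground state is Tasaki's coefficient
`g[σ̃]` of the spin-system representation `Φ = Σ_{σ̃} g[σ̃] (Π_{y∈E} b†_{y,σ(y)}) Φ_vac`. [cite: Tasaki1998PTP, §6.4 (spin-system representation of a ground state)] -/
def extConfig (α : Finset Λ) : Finset (Orb Λ) := pairSet α (E \ α)

/-- The number of occupied INTERNAL orbitals of a configuration. [folklore] -/
def intCount (s : Finset (Orb Λ)) : ℕ := (s.filter fun o => (ofLex o).1 ∉ E).card

variable {E cell lam}

/-- Membership in `extConfig`. [folklore] -/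
private theorem mem_extConfig_iff {α : Finset Λ} (o : Orb Λ) :
    o ∈ extConfig E α ↔
      ((ofLex o).2 = 0 ∧ (ofLex o).1 ∈ α) ∨ ((ofLex o).2 = 1 ∧ (ofLex o).1 ∈ E \ α) := by
  rw [extConfig, mem_pairSet]

/-- `extConfig` has no internal orbital (for `α ⊆ E`). [folklore] -/
private theorem intCount_extConfig {α : Finset Λ} (hα : α ⊆ E) : intCount E (extConfig E α) = 0 := by
  rw [intCount, card_eq_zero, filter_eq_empty_iff]
  intro o ho h
  rcases (mem_extConfig_iff o).1 ho with ⟨-, h1⟩ | ⟨-, h1⟩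
  · exact h (hα h1)
  · exact h (mem_sdiff.1 h1).1

/-- `extConfig` has `|E|` electrons (for `α ⊆ E`). [folklore] -/
private theorem card_extConfig {α : Finset Λ} (hα : α ⊆ E) : (extConfig E α).card = E.card := by
  rw [extConfig, card_pairSet, card_sdiff_of_subset hα, Nat.add_sub_cancel' (card_le_card hα)]

/-- `extConfig` has no doubly occupied site. [folklore] -/
private theorem not_hasDoubleOccupancy_extConfig (α : Finset Λ) : ¬ HasDoubleOccupancy (extConfig E α) := by
  rintro ⟨x, h0, h1⟩
  rw [extConfig, orb_zero_mem_pairSet] at h0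
  rw [extConfig, orb_one_mem_pairSet, mem_sdiff] at h1
  exact h1.2 h0

/-- The up part of `extConfig E α` is `α`. [folklore] -/
private theorem upPart_extConfig (α : Finset Λ) : upPart (extConfig E α) = α := by
  rw [extConfig, upPart_pairSet]

/-- **Structure of internal-free configurations.** A configuration with `|E|` electrons, all on
external sites, and no double occupancy is `extConfig E (upPart s)`. [folklore] -/
private theorem eq_extConfig_of_intCount_eq_zero {s : Finset (Orb Λ)} (h0 : intCount E s = 0)
    (hG : ¬ HasDoubleOccupancy s) (hc : s.card = E.card) :
    upPart s ⊆ E ∧ s = extConfig E (upPart s) := by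
  rw [intCount, card_eq_zero, filter_eq_empty_iff] at h0
  have hext : ∀ o ∈ s, (ofLex o).1 ∈ E := fun o ho => by
    by_contra h; exact h0 ho h
  have hup : upPart s ⊆ E := fun x hx => hext (orb x 0) ((mem_upPart s x).1 hx)
  have hdn : downPart s ⊆ E := fun x hx => hext (orb x 1) ((mem_downPart s x).1 hx)
  have hdisj : Disjoint (upPart s) (downPart s) := by
    rw [Finset.disjoint_left]
    intro x hx hx'
    exact hG ⟨x, (mem_upPart s x).1 hx, (mem_downPart s x).1 hx'⟩
  have hunion : upPart s ∪ downPart s = E := by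
    apply eq_of_subset_of_card_le (union_subset hup hdn)
    rw [card_union_of_disjoint hdisj, ← card_eq_upPart_add_downPart, hc]
  have hdown : downPart s = E \ upPart s := by
    rw [← hunion, union_sdiff_left, sdiff_eq_self_of_disjoint hdisj.symm]
  refine ⟨hup, ?_⟩
  conv_lhs => rw [← pairSet_upPart_downPart s, hdown]
  rfl

omit [Fintype Λ] in
/-- A configuration with a positive internal count contains an internal orbital. [folklore] -/
private theorem exists_internal_of_intCount_ne_zero {s : Finset (Orb Λ)} (h : intCount E s ≠ 0) :
    ∃ i σ, i ∉ E ∧ orb i σ ∈ s := by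
  rw [intCount, Ne, card_eq_zero, ← Ne, ← nonempty_iff_ne_empty] at h
  obtain ⟨o, ho⟩ := h
  rw [mem_filter] at ho
  refine ⟨(ofLex o).1, (ofLex o).2, ho.2, ?_⟩
  have : orb (ofLex o).1 (ofLex o).2 = o := toLex_ofLex o
  rw [this]; exact ho.1

omit [Fintype Λ] in
/-- Erasing an internal orbital lowers the internal count by one. [folklore] -/
private theorem intCount_erase_of_internal {s : Finset (Orb Λ)} {i : Λ} {σ : Fin 2} (hi : i ∉ E)
    (h : orb i σ ∈ s) : intCount E (s.erase (orb i σ)) + 1 = intCount E s := by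
  rw [intCount, intCount, filter_erase, card_erase_add_one]
  exact mem_filter.2 ⟨h, by simpa [orb] using hi⟩

omit [Fintype Λ] in
/-- Inserting an external orbital does not change the internal count. [folklore] -/
private theorem intCount_insert_of_external {s : Finset (Orb Λ)} {y : Λ} (σ : Fin 2) (hy : y ∈ E) :
    intCount E (insert (orb y σ) s) = intCount E s := by
  rw [intCount, intCount, filter_insert, if_neg (by simpa [orb] using hy)]

/-- `C_σ(λ^{(i)}) = λ c_{iσ} + F_{iσ}` when `i ∉ cell i`. [cite: Tasaki1998PTP, §6.1, eq. (6.3) and §6.4 (`{c_{x,σ}, b†_{y,σ'}} = -δ χ[y ∈ E_x]`)] -/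
theorem fieldAnn_cellVec_eq {i : Λ} (hi : i ∉ cell i) (σ : Fin 2) :
    fieldAnn (cellVec cell lam i) σ = (lam : ℂ) • annihilation (orb i σ) + cellAnn cell i σ := by
  rw [fieldAnn, ← Finset.add_sum_erase _ _ (mem_univ i), cellVec_self, cellAnn]
  congr 1
  symm
  rw [show ∑ y ∈ cell i, annihilation (orb y σ) =
      ∑ y ∈ cell i, (cellVec cell lam i y : ℂ) • (annihilation (orb y σ) : Matrix (Finset (Orb Λ)) _ ℂ) from
    sum_congr rfl fun y hy => by
      rw [cellVec_of_ne cell lam (fun h : y = i => hi (h ▸ hy)), if_pos hy, Complex.ofReal_one, one_smul]]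
  exact Finset.sum_subset (fun y hy => mem_erase.2 ⟨fun h : y = i => hi (h ▸ hy), mem_univ y⟩)
    (fun y hy hyc => by
      rw [cellVec_of_ne cell lam (ne_of_mem_erase hy), if_neg hyc, Complex.ofReal_zero, zero_smul])

/-- The action of the cell annihilator: `(F_{iσ} ψ)(s) = Σ_{y ∈ cell i} [yσ ∉ s] jwSign · ψ(s ∪ {yσ})`.
[folklore] -/
private theorem cellAnn_mulVec_apply (i : Λ) (σ : Fin 2) (ψ : Fock (Orb Λ)) (s : Finset (Orb Λ)) :
    (cellAnn cell i σ *ᵥ ψ) s =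
      ∑ y ∈ cell i, if orb y σ ∉ s then jwSign (orb y σ) s * ψ (insert (orb y σ) s) else 0 := by
  rw [cellAnn, sum_mulVec, Finset.sum_apply]
  exact sum_congr rfl fun y _ => annihilation_mulVec_apply _ ψ s

/-- **Elimination of an internal orbital** [the kernel condition `C_σ(λ^{(i)})Φ = 0` in amplitudes]:
for `iσ ∉ s`, `λ · jwSign(iσ, s) Φ(s ∪ {iσ}) = -Σ_{y ∈ cell i, yσ ∉ s} jwSign(yσ, s) Φ(s ∪ {yσ})`.
[cite: Tasaki1998PTP, §5.1 (the condition `H_hop Φ = 0`) with Appendix "Positive semidefinite operators", last lemma (`B†BΦ = 0 ⇒ BΦ = 0`)] -/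
theorem amp_insert_internal {i : Λ} (hi : i ∉ cell i) {σ : Fin 2} {ψ : Fock (Orb Λ)}
    (hK : fieldAnn (cellVec cell lam i) σ *ᵥ ψ = 0) {s : Finset (Orb Λ)} (hs : orb i σ ∉ s) :
    (lam : ℂ) * (jwSign (orb i σ) s * ψ (insert (orb i σ) s)) =
      -∑ y ∈ cell i, if orb y σ ∉ s then jwSign (orb y σ) s * ψ (insert (orb y σ) s) else 0 := by
  have h := congrFun hK s
  rw [fieldAnn_cellVec_eq hi, add_mulVec, Pi.add_apply, smul_mulVec, Pi.smul_apply, smul_eq_mul,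
    annihilation_mulVec_apply, if_pos hs, cellAnn_mulVec_apply, Pi.zero_apply] at h
  exact eq_neg_of_add_eq_zero_left h

/-- **The external amplitudes determine a zero-energy vector** (replaces [Tasaki 1998, Lemma 2.3]
in the expansion of a ground state in the states `Π b† Φ_vac`): if `C_σ(λ^{(i)})Φ = 0` for all internal `i` and both spins, `Φ` has `|E|`
particles and no double occupancy, and `Φ` vanishes on every `extConfig E α` (`α ⊆ E`), then
`Φ = 0`. Induction on the number of internal orbitals, using `amp_insert_internal`.
[cite: Tasaki1998PTP, §6.4 (representation of a ground state in the `b†`-basis, first two displays)] -/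
theorem eq_zero_of_forall_extConfig (hcell : ∀ i, i ∉ E → cell i ⊆ E) (hlam : lam ≠ 0)
    {ψ : Fock (Orb Λ)} (hK : ∀ i, i ∉ E → ∀ σ : Fin 2, fieldAnn (cellVec cell lam i) σ *ᵥ ψ = 0)
    (hN : IsNParticle E.card ψ) (hG : IsGutzwiller ψ)
    (hext : ∀ α, α ⊆ E → ψ (extConfig E α) = 0) : ψ = 0 := by
  suffices h : ∀ n (s : Finset (Orb Λ)), intCount E s = n → ψ s = 0 from funext fun s => h _ s rfl
  intro n
  induction n using Nat.strong_induction_on with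
  | _ n ih =>
    intro s hs
    by_cases hn : n = 0
    · subst hn
      by_cases hc : s.card = E.card
      · by_cases hd : HasDoubleOccupancy s
        · exact hG s hd
        · obtain ⟨hup, heq⟩ := eq_extConfig_of_intCount_eq_zero hs hd hc
          rw [heq]
          exact hext _ hup
      · exact hN s hc
    · obtain ⟨i, σ, hiE, hiσ⟩ := exists_internal_of_intCount_ne_zero (hs ▸ hn :  intCount E s ≠ 0)
      have hi : i ∉ cell i := fun h => hiE (hcell i hiE h)
      have hs's : insert (orb i σ) (s.erase (orb i σ)) = s := insert_erase hiσ
      have hlt : intCount E (s.erase (orb i σ)) < n := by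
        have := intCount_erase_of_internal (E := E) hiE hiσ
        omega
      have key := amp_insert_internal hi (hK i hiE σ) (s := s.erase (orb i σ)) (notMem_erase _ _)
      rw [hs's] at key
      have hzero : ∑ y ∈ cell i,
          (if orb y σ ∉ s.erase (orb i σ) then jwSign (orb y σ) (s.erase (orb i σ)) *
            ψ (insert (orb y σ) (s.erase (orb i σ))) else 0) = 0 := by
        refine sum_eq_zero fun y hy => ?_
        by_cases hy' : orb y σ ∈ s.erase (orb i σ)
        · rw [if_neg (not_not_intro hy')]
        · rw [if_pos hy',
            ih _ (by rw [intCount_insert_of_external σ (hcell i hiE hy)]; exact hlt) _ rfl, mul_zero]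
      rw [hzero, neg_zero] at key
      rcases mul_eq_zero.1 key with h | h
      · exact absurd (by exact_mod_cast h) hlam
      · rcases mul_eq_zero.1 h with h | h
        · exact absurd h (jwSign_ne_zero _ _)
        · exact h

end Elimination

/-! ### The exchange relation from the no-double-occupancy condition at an internal site -/

section Exchange

variable {E : Finset Λ} {cell : Λ → Finset Λ} {lam : ℝ}

/-- The cell annihilator is the field operator of the indicator of the cell. [folklore] -/
private theorem cellAnn_eq_fieldAnn (cell : Λ → Finset Λ) (i : Λ) (σ : Fin 2) :
    cellAnn cell i σ = fieldAnn (fun y => if y ∈ cell i then (1 : ℝ) else 0) σ := by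
  rw [cellAnn, fieldAnn, ← Finset.sum_subset (subset_univ (cell i))]
  · exact sum_congr rfl fun y hy => by rw [if_pos hy, Complex.ofReal_one, one_smul]
  · intro y _ hy; rw [if_neg hy, Complex.ofReal_zero, zero_smul]

/-- `c_{i↓} c_{i↑} Φ = 0` for a vector without double occupancy. [cite: Tasaki1998PTP, §5.3 (the condition `c_{x↓} c_{x↑} Φ = 0` derived from `Σ_x n_{x↑}n_{x↓} Φ = 0`)] -/
theorem annihilation_mul_annihilation_mulVec_of_isGutzwiller {ψ : Fock (Orb Λ)} (hG : IsGutzwiller ψ)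
    (x : Λ) : (annihilation (orb x 1) * annihilation (orb x 0)) *ᵥ ψ = 0 := by
  funext s
  rw [← mulVec_mulVec, annihilation_mulVec_apply, Pi.zero_apply]
  by_cases h1 : orb x 1 ∈ s
  · rw [if_neg (not_not_intro h1)]
  · rw [if_pos h1, annihilation_mulVec_apply]
    by_cases h0 : orb x 0 ∈ insert (orb x 1) s
    · rw [if_neg (not_not_intro h0), mul_zero]
    · rw [if_pos h0, hG _ ⟨x, mem_insert_self _ _, mem_insert_of_mem (mem_insert_self _ _)⟩,
        mul_zero, mul_zero]

/-- **The cell relation** `(Σ_{y ∈ cell i} c_{y↑})(Σ_{z ∈ cell i} c_{z↓}) Φ = 0`: from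
`C_σ(λ^{(i)})Φ = 0` (`λ c_{iσ}Φ = -F_{iσ}Φ`) and `c_{i↓}c_{i↑}Φ = 0`, since
`λ² c_{i↓}c_{i↑} = F_{i↓}F_{i↑}` on `Φ` up to sign. This is the operator content of the display computing
`c_{x↓}c_{x↑}Φ` for an internal `x`. [cite: Tasaki1998PTP, §6.4 (the display for `c_{x,↓}c_{x,↑}Φ`, `x ∈ I`)] -/
theorem cellAnn_mul_cellAnn_mulVec_eq_zero {i : Λ} (hi : i ∉ cell i)
    {ψ : Fock (Orb Λ)} (hK : ∀ σ : Fin 2, fieldAnn (cellVec cell lam i) σ *ᵥ ψ = 0)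
    (hG : IsGutzwiller ψ) :
    (cellAnn cell i 0 * cellAnn cell i 1) *ᵥ ψ = 0 := by
  -- `F_σ ψ = -λ c_{iσ} ψ`
  have hF : ∀ σ : Fin 2, cellAnn cell i σ *ᵥ ψ = -((lam : ℂ) • (annihilation (orb i σ) *ᵥ ψ)) := by
    intro σ
    have h := hK σ
    rw [fieldAnn_cellVec_eq hi, add_mulVec, smul_mulVec] at h
    exact eq_neg_of_add_eq_zero_right h
  -- `F_0` anticommutes with `c_{i1}`
  have hanti : cellAnn cell i 0 * annihilation (orb i 1) = -(annihilation (orb i 1) * cellAnn cell i 0) := by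
    rw [cellAnn_eq_fieldAnn]
    exact fieldAnn_mul_annihilation _ 0 1 i
  have h2 := annihilation_mul_annihilation_mulVec_of_isGutzwiller hG i
  rw [← mulVec_mulVec] at h2 ⊢
  rw [hF 1, mulVec_neg, mulVec_smul, mulVec_mulVec, hanti, neg_mulVec, ← mulVec_mulVec, hF 0,
    mulVec_neg, mulVec_smul, h2]
  simp

/-- The punctured external configuration: every external site singly occupied except `y`, `z`,
which are empty (`↑` on `α ∖ y`, `↓` on `(E ∖ α) ∖ z`). [folklore] -/
def puncturedConfig (E : Finset Λ) (α : Finset Λ) (y z : Λ) : Finset (Orb Λ) :=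
  pairSet (α.erase y) ((E \ α).erase z)

/-- Filling the punctures one way gives `extConfig E α`. [folklore] -/
private theorem insert_insert_puncturedConfig {α : Finset Λ} {y z : Λ} (hy : y ∈ α) (hz : z ∈ E \ α) :
    insert (orb z 1) (insert (orb y 0) (puncturedConfig E α y z)) = extConfig E α := by
  rw [puncturedConfig, pairSet_insert_zero, pairSet_insert_one, insert_erase hy, insert_erase hz, extConfig]

/-- Filling the punctures the other way gives the exchanged configuration `extConfig E (α - y + z)`.
[folklore] -/
private theorem insert_insert_puncturedConfig' {α : Finset Λ} {y z : Λ} (hy : y ∈ α) (hyE : y ∈ E)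
    (hz : z ∈ E \ α) :
    insert (orb y 1) (insert (orb z 0) (puncturedConfig E α y z)) =
      extConfig E (insert z (α.erase y)) := by
  rw [puncturedConfig, pairSet_insert_zero, pairSet_insert_one, extConfig]
  congr 1
  have hzy : z ≠ y := fun h => (mem_sdiff.1 hz).2 (h ▸ hy)
  ext w
  simp only [mem_insert, mem_erase, mem_sdiff]
  obtain ⟨hzE, hzα⟩ := mem_sdiff.1 hz
  constructor
  · rintro (rfl | ⟨hwz, hwE, hwα⟩)
    · exact ⟨hyE, fun h => h.elim (fun h => hzy h.symm) fun h => h.1 rfl⟩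
    · exact ⟨hwE, fun h => h.elim (fun h => hwz h) fun h => hwα h.2⟩
  · rintro ⟨hwE, hw⟩
    by_cases hwy : w = y
    · exact Or.inl hwy
    · refine Or.inr ⟨fun h => hw (Or.inl h), hwE, fun h => hw (Or.inr ⟨hwy, h⟩)⟩

/-- Up orbitals of the punctured configuration. [folklore] -/
private theorem orb_zero_mem_puncturedConfig {α : Finset Λ} {y z w : Λ} :
    orb w 0 ∈ puncturedConfig E α y z ↔ w ≠ y ∧ w ∈ α := by
  rw [puncturedConfig, orb_zero_mem_pairSet, mem_erase]

/-- Down orbitals of the punctured configuration. [folklore] -/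
private theorem orb_one_mem_puncturedConfig {α : Finset Λ} {y z w : Λ} :
    orb w 1 ∈ puncturedConfig E α y z ↔ w ≠ z ∧ w ∈ E \ α := by
  rw [puncturedConfig, orb_one_mem_pairSet, mem_erase]

omit [Fintype Λ] in
/-- Double occupancy persists under adding electrons. [folklore] -/
private theorem hasDoubleOccupancy_insert {s : Finset (Orb Λ)} (h : HasDoubleOccupancy s)
    (o : Orb Λ) : HasDoubleOccupancy (insert o s) := by
  obtain ⟨x, h0, h1⟩ := h
  exact ⟨x, mem_insert_of_mem h0, mem_insert_of_mem h1⟩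

/-- The cell annihilator `F_{i↓}` on a configuration with a unique empty cell site `e`: only the
`e`-term survives (all other cell sites are occupied, and a down electron on top of an up electron
is killed by the no-double-occupancy of `Φ`). [folklore] -/
private theorem cellAnn_one_mulVec_apply_of_unique_empty {i : Λ} {ψ : Fock (Orb Λ)} (hG : IsGutzwiller ψ)
    {v : Finset (Orb Λ)} {e : Λ} (he : e ∈ cell i) (he1 : orb e 1 ∉ v)
    (hocc : ∀ w ∈ cell i, w ≠ e → orb w 0 ∈ v ∨ orb w 1 ∈ v) :
    (cellAnn cell i 1 *ᵥ ψ) v = jwSign (orb e 1) v * ψ (insert (orb e 1) v) := by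
  rw [cellAnn_mulVec_apply, Finset.sum_eq_single e]
  · rw [if_pos he1]
  · intro w hw hwe
    rcases hocc w hw hwe with h0 | h1
    · by_cases h1 : orb w 1 ∈ v
      · rw [if_neg (not_not_intro h1)]
      · rw [if_pos h1, hG _ ⟨w, mem_insert_of_mem h0, mem_insert_self _ _⟩, mul_zero]
    · rw [if_neg (not_not_intro h1)]
  · intro h; exact absurd he h

/-- `F_{i↓} Φ` vanishes on doubly occupied configurations. [folklore] -/
private theorem cellAnn_mulVec_apply_of_hasDoubleOccupancy {i : Λ} (σ : Fin 2) {ψ : Fock (Orb Λ)}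
    (hG : IsGutzwiller ψ) {v : Finset (Orb Λ)} (hv : HasDoubleOccupancy v) :
    (cellAnn cell i σ *ᵥ ψ) v = 0 := by
  rw [cellAnn_mulVec_apply]
  refine sum_eq_zero fun w _ => ?_
  by_cases hw : orb w σ ∈ v
  · rw [if_neg (not_not_intro hw)]
  · rw [if_pos hw, hG _ (hasDoubleOccupancy_insert hv _), mul_zero]

/-- For an empty site `w` (`w↑ ∉ u`) the Jordan–Wigner signs of `w↓` and `w↑` agree. [folklore] -/
private theorem jwSign_orb_one_of_notMem {u : Finset (Orb Λ)} {w : Λ} (h : orb w 0 ∉ u) :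
    jwSign (orb w 1) u = jwSign (orb w 0) u := by
  rw [← pairSet_upPart_downPart u, LiebTwo.jwSign_orb_one_eq, jwSign_orb_zero, LiebTwo.memSign,
    if_neg (by rwa [mem_upPart]), mul_one]

/-- **The exchange relation** `g[σ̃] = g[σ̃_{y↔z}]`: for a vector with no double occupancy obeying
the cell relation of the cell `i`, the amplitudes of the external configurations are unchanged when
the spins at two sites `y, z` of the cell are exchanged (`↑` at `y`, `↓` at `z` ↦ `↓` at `y`, `↑` at
`z`); the fermion sign works out to `+1`. [cite: Tasaki1998PTP, §6.4 (exchange relation `g[σ̃] = g[σ̃_{y↔z}]` for `y, z` in a common cell)] -/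
theorem extAmp_exchange {i : Λ} (hcellE : cell i ⊆ E) {ψ : Fock (Orb Λ)}
    (hF : (cellAnn cell i 0 * cellAnn cell i 1) *ᵥ ψ = 0) (hG : IsGutzwiller ψ) {y z : Λ}
    (hy : y ∈ cell i) (hz : z ∈ cell i) {α : Finset Λ} (hyα : y ∈ α) (hzα : z ∉ α) :
    ψ (extConfig E α) = ψ (extConfig E (insert z (α.erase y))) := by
  have hyE : y ∈ E := hcellE hy
  have hzE : z ∈ E \ α := mem_sdiff.2 ⟨hcellE hz, hzα⟩
  have hyz : y ≠ z := fun h => hzα (h ▸ hyα)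
  set u := puncturedConfig E α y z with hu
  -- membership facts
  have hy0 : orb y 0 ∉ u := fun h => (orb_zero_mem_puncturedConfig.1 h).1 rfl
  have hy1 : orb y 1 ∉ u := fun h => (mem_sdiff.1 (orb_one_mem_puncturedConfig.1 h).2).2 hyα
  have hz0 : orb z 0 ∉ u := fun h => hzα (orb_zero_mem_puncturedConfig.1 h).2
  have hz1 : orb z 1 ∉ u := fun h => (orb_one_mem_puncturedConfig.1 h).1 rfl
  -- every other cell site is occupied in `u`
  have hocc : ∀ w ∈ cell i, w ≠ y → w ≠ z → orb w 0 ∈ u ∨ orb w 1 ∈ u := by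
    intro w hw hwy hwz
    by_cases hwα : w ∈ α
    · exact Or.inl (orb_zero_mem_puncturedConfig.2 ⟨hwy, hwα⟩)
    · exact Or.inr (orb_one_mem_puncturedConfig.2 ⟨hwz, mem_sdiff.2 ⟨hcellE hw, hwα⟩⟩)
  -- the inner sums
  have hin_y : (cellAnn cell i 1 *ᵥ ψ) (insert (orb y 0) u) =
      jwSign (orb z 1) (insert (orb y 0) u) * ψ (extConfig E α) := by
    rw [cellAnn_one_mulVec_apply_of_unique_empty hG hz (by simp [hz1, hyz.symm]),
      insert_insert_puncturedConfig hyα hzE]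
    intro w hw hwz
    by_cases hwy : w = y
    · exact Or.inl (hwy ▸ mem_insert_self _ _)
    · rcases hocc w hw hwy hwz with h | h
      · exact Or.inl (mem_insert_of_mem h)
      · exact Or.inr (mem_insert_of_mem h)
  have hin_z : (cellAnn cell i 1 *ᵥ ψ) (insert (orb z 0) u) =
      jwSign (orb y 1) (insert (orb z 0) u) * ψ (extConfig E (insert z (α.erase y))) := by
    rw [cellAnn_one_mulVec_apply_of_unique_empty hG hy (by simp [hy1, hyz]),
      insert_insert_puncturedConfig' hyα hyE hzE]
    intro w hw hwy
    by_cases hwz : w = z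
    · exact Or.inl (hwz ▸ mem_insert_self _ _)
    · rcases hocc w hw hwy hwz with h | h
      · exact Or.inl (mem_insert_of_mem h)
      · exact Or.inr (mem_insert_of_mem h)
  -- evaluate the cell relation at `u`
  have h := congrFun hF u
  rw [← mulVec_mulVec, cellAnn_mulVec_apply, Pi.zero_apply, ← Finset.add_sum_erase _ _ hy,
    ← Finset.add_sum_erase _ _ (mem_erase.2 ⟨hyz.symm, hz⟩), if_pos hy0, if_pos hz0, hin_y, hin_z,
    Finset.sum_eq_zero, add_zero] at h
  swap
  · intro w hw
    obtain ⟨hwz, hw'⟩ := mem_erase.1 hw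
    obtain ⟨hwy, hw⟩ := mem_erase.1 hw'
    rcases hocc w hw hwy hwz with h0 | h1
    · rw [if_neg (not_not_intro h0)]
    · by_cases h0 : orb w 0 ∈ u
      · rw [if_neg (not_not_intro h0)]
      · rw [if_pos h0, cellAnn_mulVec_apply_of_hasDoubleOccupancy 1 hG
          ⟨w, mem_insert_self _ _, mem_insert_of_mem h1⟩, mul_zero]
  -- the signs
  rw [jwSign_orb_one_of_notMem (by simp [hz0, hyz.symm] : orb z 0 ∉ insert (orb y 0) u),
    jwSign_orb_one_of_notMem (by simp [hy0, hyz] : orb y 0 ∉ insert (orb z 0) u)] at h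
  have hsy : jwSign (orb y 0) u ≠ 0 := jwSign_ne_zero _ _
  have hsz : jwSign (orb z 0) u ≠ 0 := jwSign_ne_zero _ _
  rcases lt_or_gt_of_ne hyz with hlt | hlt
  · -- `y < z`: the `z`-sign flips, the `y`-sign does not
    rw [jwSign_insert_of_lt hy0 ((orb_lt_orb_zero_iff y 0 z).2 hlt),
      jwSign_insert_of_not_lt (fun h' => lt_asymm hlt ((orb_lt_orb_zero_iff z 0 y).1 h'))] at h
    have : jwSign (orb y 0) u * jwSign (orb z 0) u *
        (ψ (extConfig E (insert z (α.erase y))) - ψ (extConfig E α)) = 0 := by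
      linear_combination h
    rcases mul_eq_zero.1 this with h' | h'
    · exact absurd h' (mul_ne_zero hsy hsz)
    · exact (sub_eq_zero.1 h').symm
  · -- `z < y`
    rw [jwSign_insert_of_not_lt (fun h' => lt_asymm hlt ((orb_lt_orb_zero_iff y 0 z).1 h')),
      jwSign_insert_of_lt hz0 ((orb_lt_orb_zero_iff z 0 y).2 hlt)] at h
    have : jwSign (orb y 0) u * jwSign (orb z 0) u *
        (ψ (extConfig E α) - ψ (extConfig E (insert z (α.erase y)))) = 0 := by
      linear_combination h
    rcases mul_eq_zero.1 this with h' | h'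
    · exact absurd h' (mul_ne_zero hsy hsz)
    · exact sub_eq_zero.1 h'

end Exchange

/-! ### Connectivity: the external amplitudes are constant on each `S^z` sector -/

section Connectivity

variable {E : Finset Λ} {cell : Λ → Finset Λ} {lam : ℝ}

omit [LinearOrder Λ] [Fintype Λ] in
/-- Adjacency in the cell graph: two distinct external sites in a common cell. [cite: Tasaki1998PTP, §6.1 ("the whole lattice is connected via nonvanishing `t_{x,y}`")] -/
theorem cellGraph_adj_iff {y z : ↥E} :
    (cellGraph E cell).Adj y z ↔ y ≠ z ∧ ∃ i, i ∉ E ∧ (y : Λ) ∈ cell i ∧ (z : Λ) ∈ cell i := by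
  rw [cellGraph, SimpleGraph.fromRel_adj]
  constructor
  · rintro ⟨hne, h | h⟩
    · exact ⟨hne, h⟩
    · obtain ⟨i, hi, h1, h2⟩ := h
      exact ⟨hne, i, hi, h2, h1⟩
  · rintro ⟨hne, h⟩
    exact ⟨hne, Or.inl h⟩

/-- One token-sliding move in the cell graph does not change the external amplitude (the exchange
relation read along an edge of the cell graph). [cite: Tasaki1998PTP, §6.4 (exchange relation `g[σ̃] = g[σ̃_{y↔z}]`)] -/
theorem extAmp_eq_of_isHop (hcell : ∀ i, i ∉ E → cell i ⊆ E) {ψ : Fock (Orb Λ)}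
    (hK : ∀ i, i ∉ E → ∀ σ : Fin 2, fieldAnn (cellVec cell lam i) σ *ᵥ ψ = 0) (hG : IsGutzwiller ψ)
    {γ δ : Finset ↥E} (h : IsHop (cellGraph E cell) γ δ) :
    ψ (extConfig E (γ.map (Function.Embedding.subtype _))) =
      ψ (extConfig E (δ.map (Function.Embedding.subtype _))) := by
  obtain ⟨x, y, hadj, hyγ, hxγ, rfl⟩ := h
  obtain ⟨hne, i, hiE, hx, hy⟩ := cellGraph_adj_iff.1 hadj
  have hi : i ∉ cell i := fun h => hiE (hcell i hiE h)
  have hF := cellAnn_mul_cellAnn_mulVec_eq_zero hi (hK i hiE) hG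
  rw [Finset.map_insert, Finset.map_erase]
  exact extAmp_exchange (hcell i hiE) hF hG hy hx (by simpa using hyγ) (by simpa using hxγ)

/-- **Constancy on `S^z` sectors.** If the external sites are connected through the cells, the
external amplitudes of a zero-energy vector depend only on the number of up spins: "all the
`g[σ̃]` with common `S^z_tot` assume exactly the same values". [cite: Tasaki1998PTP, §6.4 (last
paragraph) and §5.3 (last paragraph)] -/
theorem extAmp_const_of_card_eq (hcell : ∀ i, i ∉ E → cell i ⊆ E)
    (hconn : (cellGraph E cell).Preconnected) {ψ : Fock (Orb Λ)}
    (hK : ∀ i, i ∉ E → ∀ σ : Fin 2, fieldAnn (cellVec cell lam i) σ *ᵥ ψ = 0) (hG : IsGutzwiller ψ)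
    {α β : Finset Λ} (hα : α ⊆ E) (hβ : β ⊆ E) (hcard : α.card = β.card) :
    ψ (extConfig E α) = ψ (extConfig E β) := by
  classical
  set emb : ↥E ↪ Λ := Function.Embedding.subtype _ with hemb
  have key : ∀ γ δ : Finset ↥E, Relation.ReflTransGen (IsHop (cellGraph E cell)) γ δ →
      ψ (extConfig E (γ.map emb)) = ψ (extConfig E (δ.map emb)) := by
    intro γ δ h
    induction h with
    | refl => rfl
    | tail _ hstep ih => rw [ih, extAmp_eq_of_isHop hcell hK hG hstep]
  have hα' : (α.subtype (· ∈ E)).map emb = α := Finset.subtype_map_of_mem hα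
  have hβ' : (β.subtype (· ∈ E)).map emb = β := Finset.subtype_map_of_mem hβ
  have hc : (α.subtype (· ∈ E)).card = (β.subtype (· ∈ E)).card := by
    rw [Finset.card_subtype, Finset.card_subtype, Finset.filter_true_of_mem hα,
      Finset.filter_true_of_mem hβ, hcard]
  rw [← hα', ← hβ']
  exact key _ _ (reflTransGen_isHop hconn hc)

/-- The sector of an external configuration. [folklore] -/
private theorem extConfig_card_upPart_downPart {α : Finset Λ} (hα : α ⊆ E) :
    (upPart (extConfig E α)).card = α.card ∧ (downPart (extConfig E α)).card = E.card - α.card := by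
  rw [extConfig, upPart_pairSet, downPart_pairSet, card_sdiff_of_subset hα]
  exact ⟨rfl, rfl⟩

/-- **At most one zero-energy vector per `S^z` sector** ("the lowest energy state is unique in each
sector with a fixed `S^z_tot`"): two zero-energy vectors (kernel conditions + no double occupancy,
`|E|` particles) in the same `(a, |E| - a)` sector are proportional.
[cite: Tasaki1998PTP, §6.4 (end of the proof of Theorem 6.1)] -/
theorem exists_smul_of_sector (hcell : ∀ i, i ∉ E → cell i ⊆ E) (hlam : lam ≠ 0)
    (hconn : (cellGraph E cell).Preconnected) {a : ℕ} {ψ φ : Fock (Orb Λ)}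
    (hKψ : ∀ i, i ∉ E → ∀ σ : Fin 2, fieldAnn (cellVec cell lam i) σ *ᵥ ψ = 0) (hGψ : IsGutzwiller ψ)
    (hSψ : IsInSector a (E.card - a) ψ)
    (hKφ : ∀ i, i ∉ E → ∀ σ : Fin 2, fieldAnn (cellVec cell lam i) σ *ᵥ φ = 0) (hGφ : IsGutzwiller φ)
    (hSφ : IsInSector a (E.card - a) φ) (hφ0 : φ ≠ 0) (ha : a ≤ E.card) :
    ∃ c : ℂ, ψ = c • φ := by
  have hNψ : IsNParticle E.card ψ := by
    have := hSψ.isNParticle; rwa [Nat.add_sub_cancel' ha] at this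
  have hNφ : IsNParticle E.card φ := by
    have := hSφ.isNParticle; rwa [Nat.add_sub_cancel' ha] at this
  -- a reference configuration where `φ` does not vanish
  obtain ⟨α₀, hα₀, hφα₀⟩ : ∃ α₀, α₀ ⊆ E ∧ φ (extConfig E α₀) ≠ 0 := by
    by_contra h
    push Not at h
    exact hφ0 (eq_zero_of_forall_extConfig hcell hlam hKφ hNφ hGφ h)
  have hα₀a : α₀.card = a := by
    by_contra hne
    apply hφα₀
    refine hSφ _ fun h' => hne ?_
    rw [← h'.1, (extConfig_card_upPart_downPart hα₀).1]
  set c : ℂ := ψ (extConfig E α₀) / φ (extConfig E α₀) with hc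
  refine ⟨c, ?_⟩
  -- `χ = ψ - c φ` satisfies the same conditions and has vanishing external amplitudes
  rw [← sub_eq_zero]
  refine eq_zero_of_forall_extConfig hcell hlam (fun i hi σ => ?_) (fun s hs => ?_) (fun s hs => ?_)
    (fun α hα => ?_)
  · rw [mulVec_sub, mulVec_smul, hKψ i hi σ, hKφ i hi σ, smul_zero, sub_zero]
  · rw [Pi.sub_apply, Pi.smul_apply, hNψ s hs, hNφ s hs, smul_zero, sub_zero]
  · rw [Pi.sub_apply, Pi.smul_apply, hGψ s hs, hGφ s hs, smul_zero, sub_zero]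
  · rw [Pi.sub_apply, Pi.smul_apply, smul_eq_mul]
    by_cases hαa : α.card = a
    · rw [extAmp_const_of_card_eq hcell hconn hKψ hGψ hα hα₀ (hαa.trans hα₀a.symm),
        extAmp_const_of_card_eq hcell hconn hKφ hGφ hα hα₀ (hαa.trans hα₀a.symm), hc,
        div_mul_cancel₀ _ hφα₀, sub_self]
    · have hsec : ¬((upPart (extConfig E α)).card = a ∧ (downPart (extConfig E α)).card = E.card - a) :=
        fun h' => hαa (by rw [← h'.1, (extConfig_card_upPart_downPart hα).1])
      rw [hSψ _ hsec, hSφ _ hsec, mul_zero, sub_zero]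

end Connectivity

/-! ### The saturated ferromagnetic zero-energy state `Ψ↑ = Π_{y ∈ E} b†_{y↑} |0⟩` -/

section FerroState

variable (E : Finset Λ) (cell : Λ → Finset Λ) (lam : ℝ)

/-- Tasaki's localised flat-band vector `φ^{(y)} = λ δ_y - Σ_{i ∉ E : y ∈ cell i} δ_i` of the external
site `y`. [cite: Tasaki1998PTP, §6.3, eq. (6.6) (definition of `φ^{(y)}`)] -/
def locVec (y : Λ) : Λ → ℝ :=
  fun x => if x = y then lam else if x ∉ E ∧ y ∈ cell x then -1 else 0

/-- The creation operator `b†_{y↑} = C†_↑(φ^{(y)})` of a spin-up electron in the localised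
flat-band state at `y`. [cite: Tasaki1998PTP, §6.4 ("introducing `b†_{yσ} = C†_σ(φ^{(y)})`")] -/
def locCre (y : Λ) : Matrix (Finset (Orb Λ)) (Finset (Orb Λ)) ℂ := fieldCre (locVec E cell lam y) 0

/-- The product state `Π_{y ∈ L} b†_{y↑} |0⟩` over a list of external sites. [cite: Tasaki1998PTP,
§5.1 ("there are ferromagnetic states among the ground states")] -/
def locProd (L : List Λ) : Fock (Orb Λ) := (L.map (locCre E cell lam)).prod *ᵥ vacuum

/-- **The saturated ferromagnetic state** `Ψ↑ = Π_{y ∈ E} b†_{y↑} |0⟩` (product in increasing order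
of the sites). [cite: Tasaki1998PTP, §5.1 and §6.4] -/
def ferroState : Fock (Orb Λ) := locProd E cell lam (E.sort (· ≤ ·))

variable {E cell lam}

/-- **Orthogonality `⟨λ^{(i)}, φ^{(y)}⟩ = 0`** for an internal `i` (with `cell i ⊆ E`) and an external
`y`. [cite: Tasaki1998PTP, §6.3, eq. (6.7) (`⟨λ^{(j)}, φ^{(y)}⟩ = 0`)] -/
theorem sum_cellVec_mul_locVec (hcell : ∀ i, i ∉ E → cell i ⊆ E) {i : Λ} (hi : i ∉ E) {y : Λ}
    (hy : y ∈ E) : ∑ x, cellVec cell lam i x * locVec E cell lam y x = 0 := by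
  have hiy : i ≠ y := fun h => hi (h ▸ hy)
  have hic : i ∉ cell i := fun h => hi (hcell i hi h)
  rw [← Finset.add_sum_erase _ _ (mem_univ i), ← Finset.add_sum_erase _ _ (mem_erase.2 ⟨hiy.symm, mem_univ y⟩),
    Finset.sum_eq_zero]
  · rw [cellVec_self, cellVec_of_ne cell lam hiy.symm, locVec, locVec, if_neg hiy, if_pos rfl]
    by_cases hyc : y ∈ cell i
    · rw [if_pos ⟨hi, hyc⟩, if_pos hyc]; ring
    · rw [if_neg (fun h => hyc h.2), if_neg hyc]; ring
  · intro x hx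
    obtain ⟨hxy, hx'⟩ := mem_erase.1 hx
    obtain ⟨hxi, -⟩ := mem_erase.1 hx'
    rw [cellVec_of_ne cell lam hxi, locVec, if_neg hxy]
    by_cases hxc : x ∈ cell i
    · rw [if_pos hxc, one_mul, if_neg (fun h => h.1 (hcell i hi hxc))]
    · rw [if_neg hxc, zero_mul]

/-- `C_σ(λ^{(i)})` anticommutes with every `b†_{y↑}`. [cite: Tasaki1998PTP, §5.3 ("which satisfies
`[H_hop, b†] = 0` because of the general commutation rule")] -/
theorem fieldAnn_cellVec_mul_locCre (hcell : ∀ i, i ∉ E → cell i ⊆ E) {i : Λ} (hi : i ∉ E)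
    (σ : Fin 2) {y : Λ} (hy : y ∈ E) :
    fieldAnn (cellVec cell lam i) σ * locCre E cell lam y =
      -(locCre E cell lam y * fieldAnn (cellVec cell lam i) σ) := by
  have h := fieldAnn_mul_fieldCre_add (cellVec cell lam i) (locVec E cell lam y) σ 0
  rw [sum_cellVec_mul_locVec hcell hi hy] at h
  simp only [Complex.ofReal_zero, zero_smul, ite_self] at h
  exact eq_neg_of_add_eq_zero_left h

/-- `C_σ(λ^{(i)})` kills every product state `Π b†_{y↑} |0⟩`. [cite: Tasaki1998PTP, §6.3, eq. (6.7) (`T φ^{(y)} = 0`) and §5.3 (`[H_hop, b†_{yσ}] = 0`)] -/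
theorem fieldAnn_cellVec_mulVec_locProd (hcell : ∀ i, i ∉ E → cell i ⊆ E) {i : Λ} (hi : i ∉ E)
    (σ : Fin 2) {L : List Λ} (hL : ∀ y ∈ L, y ∈ E) :
    fieldAnn (cellVec cell lam i) σ *ᵥ locProd E cell lam L = 0 := by
  induction L with
  | nil => rw [locProd, List.map_nil, List.prod_nil, one_mulVec, fieldAnn_mulVec_vacuum]
  | cons y L ih =>
    rw [locProd, List.map_cons, List.prod_cons]
    have hre : (locCre E cell lam y * (L.map (locCre E cell lam)).prod) *ᵥ (vacuum : Fock (Orb Λ)) =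
        locCre E cell lam y *ᵥ locProd E cell lam L := by
      rw [← mulVec_mulVec, locProd]
    rw [hre, mulVec_mulVec, fieldAnn_cellVec_mul_locCre hcell hi σ (hL y (by simp)), neg_mulVec,
      ← mulVec_mulVec, ih (fun z hz => hL z (by simp [hz])), mulVec_zero, neg_zero]

/-- Support of the product states: only spin-up orbitals, as many as factors. [folklore] -/
private theorem locProd_apply_ne_zero {L : List Λ} {s : Finset (Orb Λ)} (h : locProd E cell lam L s ≠ 0) :
    (∀ o ∈ s, (ofLex o).2 = 0) ∧ s.card = L.length := by
  induction L generalizing s with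
  | nil =>
    rw [locProd, List.map_nil, List.prod_nil, one_mulVec, vacuum] at h
    by_cases hs : s = ∅
    · subst hs; simp
    · exact absurd (Pi.single_eq_of_ne hs _) h
  | cons y L ih =>
    rw [locProd, List.map_cons, List.prod_cons, ← mulVec_mulVec, ← locProd, locCre, fieldCre, sum_mulVec,
      Finset.sum_apply] at h
    obtain ⟨x, -, hx⟩ := Finset.exists_ne_zero_of_sum_ne_zero h
    rw [smul_mulVec, Pi.smul_apply, smul_eq_mul, creation_mulVec_apply] at hx
    by_cases hxs : orb x 0 ∈ s
    · rw [if_pos hxs] at hx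
      have h' : locProd E cell lam L (s.erase (orb x 0)) ≠ 0 := fun h0 => by
        rw [h0, mul_zero, mul_zero] at hx; exact hx rfl
      obtain ⟨hup, hcard⟩ := ih h'
      refine ⟨fun o ho => ?_, ?_⟩
      · by_cases hox : o = orb x 0
        · rw [hox]; rfl
        · exact hup o (mem_erase.2 ⟨hox, ho⟩)
      · rw [List.length_cons, ← hcard, card_erase_add_one hxs]
    · rw [if_neg hxs, mul_zero] at hx
      exact absurd rfl hx

/-- The product states have no double occupancy. [cite: Tasaki1998PTP, §5.1 ("there is a ferromagnetic state with energy zero": `H_int Ψ↑ = 0`)] -/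
theorem isGutzwiller_locProd (L : List Λ) : IsGutzwiller (locProd E cell lam L) := by
  intro s hs
  by_contra h
  obtain ⟨x, -, h1⟩ := hs
  exact absurd ((locProd_apply_ne_zero h).1 _ h1) (by simp [orb])

/-- The product state over `L` lies in the sector `(|L|, 0)`. [cite: Tasaki1998PTP, §5.1 (the ferromagnetic states have `N↑ = N_e`, `N↓ = 0`)] -/
theorem isInSector_locProd (L : List Λ) : IsInSector L.length 0 (locProd E cell lam L) := by
  intro s hs
  by_contra h
  obtain ⟨hup, hcard⟩ := locProd_apply_ne_zero h
  have hdown : downPart s = ∅ := by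
    rw [Finset.eq_empty_iff_forall_notMem]
    intro x hx
    exact absurd (hup _ ((mem_downPart s x).1 hx)) (by simp [orb])
  apply hs
  have := card_eq_upPart_add_downPart s
  rw [hdown, card_empty, add_zero] at this
  exact ⟨this ▸ hcard, by rw [hdown, card_empty]⟩

/-- **`Ψ↑ ≠ 0`**: the amplitude of `Π_{y ∈ L} b†_{y↑}|0⟩` on the configuration `L↑` is
`± λ^{|L|}` (only the `λ c†_{y↑}` parts of the `b†`'s contribute). [cite: Tasaki1998PTP, §5.3
("each state in the sum is nonvanishing because of Lemma 2.1")] -/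
theorem locProd_apply_pairSet_ne_zero (hlam : lam ≠ 0) {L : List Λ} (hnd : L.Nodup)
    (hL : ∀ y ∈ L, y ∈ E) : locProd E cell lam L (pairSet L.toFinset ∅) ≠ 0 := by
  induction L with
  | nil => simp [locProd, vacuum, pairSet]
  | cons y L ih =>
    have hyL : y ∉ L := (List.nodup_cons.1 hnd).1
    have hyE : y ∈ E := hL y (by simp)
    have ih' := ih (List.nodup_cons.1 hnd).2 (fun z hz => hL z (by simp [hz]))
    rw [locProd, List.map_cons, List.prod_cons, ← mulVec_mulVec, ← locProd, locCre, fieldCre, sum_mulVec,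
      Finset.sum_apply, Finset.sum_eq_single y]
    · rw [smul_mulVec, Pi.smul_apply, smul_eq_mul, creation_mulVec_apply, List.toFinset_cons,
        if_pos (by simp), pairSet_erase_zero, erase_insert (by simpa using hyL), locVec, if_pos rfl]
      exact mul_ne_zero (by exact_mod_cast hlam) (mul_ne_zero (jwSign_ne_zero _ _) ih')
    · intro x _ hxy
      rw [smul_mulVec, Pi.smul_apply, smul_eq_mul, creation_mulVec_apply]
      by_cases hx : orb x 0 ∈ pairSet (List.toFinset (y :: L)) ∅
      · -- then `x ∈ L ⊆ E` is external and `≠ y`, so `φ^{(y)}_x = 0`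
        have hxE : x ∈ E := by
          rw [orb_zero_mem_pairSet, List.mem_toFinset, List.mem_cons] at hx
          exact hL x (List.mem_cons.2 hx)
        rw [locVec, if_neg hxy, if_neg (fun h => h.1 hxE), Complex.ofReal_zero, zero_mul]
      · rw [if_neg hx, mul_zero]
    · intro h; exact absurd (mem_univ y) h

/-- **Properties of `Ψ↑`**: it has `|E|` spin-up electrons, no double occupancy, is killed by every
`C_σ(λ^{(i)})`, hence `H Ψ↑ = 0`, and `Ψ↑ ≠ 0`. [cite: Tasaki1998PTP, §5.1 and §6.4] -/
theorem ferroState_spec (hcell : ∀ i, i ∉ E → cell i ⊆ E) (hlam : lam ≠ 0) :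
    IsInSector E.card 0 (ferroState E cell lam) ∧ IsGutzwiller (ferroState E cell lam) ∧
      (∀ i, i ∉ E → ∀ σ : Fin 2, fieldAnn (cellVec cell lam i) σ *ᵥ ferroState E cell lam = 0) ∧
      ferroState E cell lam ≠ 0 := by
  have hsortE : ∀ y ∈ E.sort (· ≤ ·), y ∈ E := fun y hy => (Finset.mem_sort _).1 hy
  refine ⟨?_, isGutzwiller_locProd _, fun i hi σ => fieldAnn_cellVec_mulVec_locProd hcell hi σ hsortE, ?_⟩
  · have := isInSector_locProd (E := E) (cell := cell) (lam := lam) (E.sort (· ≤ ·))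
    rwa [Finset.length_sort] at this
  · intro h
    have := locProd_apply_pairSet_ne_zero (cell := cell) hlam (E.sort_nodup _) hsortE
    rw [ferroState] at h
    rw [h] at this
    exact this rfl

end FerroState

/-! ### Symmetries of `H` -/

section Symmetry

variable (E : Finset Λ) (cell : Λ → Finset Λ) (t lam U : ℝ)

/-- `H` conserves `N↑` and `N↓`. [cite: Tasaki1998PTP, §3.1 (`H`, `S^(3)_tot` and the number operators commute)] -/
theorem preservesSectors_hamiltonian : PreservesSectors (hamiltonian E cell t lam U) := by
  rw [hamiltonian, hoppingOp, onSiteRepulsion]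
  refine PreservesSectors.add (PreservesSectors.sum fun x _ => PreservesSectors.sum fun y _ =>
    PreservesSectors.sum fun σ _ => (LiebThm1.preservesSectors_hopping x y σ).smul _)
    ((PreservesSectors.sum fun x _ => ?_).smul _)
  exact (LiebThm1.preservesSectors_numberOp x 0).mul (LiebThm1.preservesSectors_numberOp x 1)

/-- `[H, S⁺] = 0` (spin-independent hopping and on-site interaction). [cite: Tasaki1998PTP, §3.1 (`SU(2)` invariance of `H_hop` and `H_int`)] -/
theorem commute_hamiltonian_spinPlus : Commute (hamiltonian E cell t lam U) spinPlus := by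
  rw [hamiltonian, hoppingOp, onSiteRepulsion]
  refine Commute.add_left (Commute.sum_left _ _ _ fun x _ => Commute.sum_left _ _ _ fun y _ => ?_)
    (Commute.smul_left (Commute.sum_left _ _ _ fun x _ => LiebThm1.numberOp_mul_numberOp_commute_spinPlus x) _)
  rw [← Finset.smul_sum]
  exact Commute.smul_left (LiebThm1.sum_hopping_commute_spinPlus x y) _

/-- The on-site repulsion is the diagonal matrix counting doubly occupied sites. [cite: Tasaki1998PTP, §2.5 (`H_int`, Figure (f:config))] -/
theorem onSiteRepulsion_eq_diagonal :
    (onSiteRepulsion : Matrix (Finset (Orb Λ)) (Finset (Orb Λ)) ℂ) =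
      diagonal fun s => ((univ.filter fun x : Λ => orb x 0 ∈ s ∧ orb x 1 ∈ s).card : ℂ) := by
  refine Matrix.toLin'.injective (LinearMap.ext fun ψ => ?_)
  funext s
  rw [Matrix.toLin'_apply, Matrix.toLin'_apply, onSiteRepulsion_mulVec_apply, mulVec_diagonal]

/-- `H` is Hermitian. [cite: Tasaki1998PTP, §2.4–§2.6 (real symmetric `(t_{xy})`, real `U`)] -/
theorem isHermitian_hamiltonian : (hamiltonian E cell t lam U).IsHermitian := by
  have hS : (∑ i ∈ Eᶜ, ∑ σ : Fin 2,
      fieldCre (cellVec cell lam i) σ * fieldAnn (cellVec cell lam i) σ :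
        Matrix (Finset (Orb Λ)) (Finset (Orb Λ)) ℂ).IsHermitian := by
    rw [IsHermitian, conjTranspose_sum]
    refine sum_congr rfl fun i _ => ?_
    rw [conjTranspose_sum]
    refine sum_congr rfl fun σ _ => ?_
    rw [fieldCre_eq_conjTranspose]
    exact (isHermitian_conjTranspose_mul_self _).eq
  have h1 : (hoppingOp (cellHopping E cell t lam)).IsHermitian := by
    rw [hoppingOp_cellHopping_eq, IsHermitian, conjTranspose_smul, hS.eq, Complex.star_def,
      Complex.conj_ofReal]
  have h2 : (onSiteRepulsion : Matrix (Finset (Orb Λ)) (Finset (Orb Λ)) ℂ).IsHermitian := by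
    rw [onSiteRepulsion_eq_diagonal]
    exact isHermitian_diagonal_iff.2 fun s => by simp
  rw [hamiltonian]
  refine h1.add ?_
  rw [IsHermitian, conjTranspose_smul, h2.eq, Complex.star_def, Complex.conj_ofReal]

/-- `[H, S⁻] = 0`. [cite: Tasaki1998PTP, §3.1 (`SU(2)` invariance of `H`)] -/
theorem commute_hamiltonian_spinMinus : Commute (hamiltonian E cell t lam U) spinMinus := by
  have h := commute_hamiltonian_spinPlus E cell t lam U
  rw [Commute, SemiconjBy] at h ⊢
  have h' := congrArg conjTranspose h
  rw [conjTranspose_mul, conjTranspose_mul, (isHermitian_hamiltonian E cell t lam U).eq] at h'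
  exact h'.symm

end Symmetry

/-! ### Highest-weight strings of an `su(2)` triple -/

section HighestWeight

variable {ι : Type*} [Fintype ι] [DecidableEq ι] {P M Z : Matrix ι ι ℂ}

/-- Lowering string from a highest-weight vector: `S⁺ (S⁻)^{k+1} w = (k+1)(2j - k) (S⁻)^k w` for
`S⁺ w = 0`, `S^z w = j w`. [cite: BiedenharnLouck1984, Ch. 3 §3 ("The angular momentum multiplets"), eqs. (3.17)–(3.20)] -/
theorem su2_raise_lower_pow (h : IsSu2Triple P M Z) {w : ι → ℂ} {j : ℂ} (hP : P *ᵥ w = 0)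
    (hZ : Z *ᵥ w = j • w) (k : ℕ) :
    P *ᵥ (M ^ (k + 1) *ᵥ w) = (((k : ℂ) + 1) * (2 * j - k)) • (M ^ k *ᵥ w) := by
  induction k with
  | zero =>
    rw [zero_add, pow_one, pow_zero, one_mulVec, mulVec_mulVec w P M, h.PM, add_mulVec, add_mulVec,
      ← mulVec_mulVec, hP, mulVec_zero, zero_add, hZ, ← add_smul]
    congr 1; push_cast; ring
  | succ k ih =>
    have hX : M ^ (k + 1 + 1) *ᵥ w = M *ᵥ (M ^ (k + 1) *ᵥ w) := by rw [pow_succ', ← mulVec_mulVec]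
    have hZX := h.weight_M_pow hZ (k + 1)
    rw [hX, mulVec_mulVec (M ^ (k + 1) *ᵥ w) P M, h.PM, add_mulVec, add_mulVec, ← mulVec_mulVec, ih,
      mulVec_smul, mulVec_mulVec w M (M ^ k), ← pow_succ', hZX, ← add_smul, ← add_smul]
    congr 1; push_cast; ring

/-- The lowering string of a highest-weight vector of weight `N/2` does not break before `N` steps:
`(S⁻)^k w ≠ 0` for `k ≤ N` (`‖S⁻ v_k‖² = (k+1)(N-k) ‖v_k‖²`). [cite: BiedenharnLouck1984, Ch. 3 §3 ("The angular momentum multiplets"), eqs. (3.17)–(3.20)] -/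
theorem su2_lower_pow_ne_zero (h : IsSu2Triple P M Z) {w : ι → ℂ} (hw : w ≠ 0) (hP : P *ᵥ w = 0)
    {N : ℕ} (hZ : Z *ᵥ w = ((N : ℂ) / 2) • w) : ∀ k, k ≤ N → M ^ k *ᵥ w ≠ 0 := by
  intro k
  induction k with
  | zero => intro _; rwa [pow_zero, one_mulVec]
  | succ k ih =>
    intro hk hzero
    have hk' : k < N := Nat.lt_of_succ_le hk
    have hvk := ih hk'.le
    have hnorm : star (M ^ (k + 1) *ᵥ w) ⬝ᵥ (M ^ (k + 1) *ᵥ w) =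
        (((k : ℂ) + 1) * (2 * ((N : ℂ) / 2) - k)) * (star (M ^ k *ᵥ w) ⬝ᵥ (M ^ k *ᵥ w)) := by
      conv_lhs => rw [pow_succ', ← mulVec_mulVec, h.star_M_mulVec_dotProduct, mulVec_mulVec w M (M ^ k),
        ← pow_succ', su2_raise_lower_pow h hP hZ k, dotProduct_smul, smul_eq_mul]
    rw [hzero, dotProduct_zero] at hnorm
    have hc : (((k : ℂ) + 1) * (2 * ((N : ℂ) / 2) - k)) ≠ 0 := by
      have : (((k : ℂ) + 1) * (2 * ((N : ℂ) / 2) - k)) = (((k + 1 : ℕ) * (N - k : ℕ) : ℕ) : ℂ) := by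
        push_cast [Nat.cast_sub hk'.le]; ring
      rw [this, Nat.cast_ne_zero]
      exact Nat.mul_ne_zero (Nat.succ_ne_zero k) (by omega)
    rcases mul_eq_zero.1 hnorm.symm with h' | h'
    · exact hc h'
    · exact hvk (dotProduct_star_self_eq_zero.1 h')

/-- The Casimir on the lowering string of a highest-weight vector of weight `j`: `C (S⁻)^k w = j(j+1) (S⁻)^k w`.
[cite: BiedenharnLouck1984, Ch. 3 §3 ("The angular momentum multiplets"), eqs. (3.17)–(3.20)] -/
theorem su2Casimir_lower_pow (h : IsSu2Triple P M Z) {w : ι → ℂ} {j : ℂ} (hP : P *ᵥ w = 0)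
    (hZ : Z *ᵥ w = j • w) (k : ℕ) :
    su2Casimir P M Z *ᵥ (M ^ k *ᵥ w) = (j * (j + 1)) • (M ^ k *ᵥ w) := by
  have hC : su2Casimir P M Z *ᵥ w = (j * (j + 1)) • w := by
    rw [h.su2Casimir_eq, add_mulVec, add_mulVec, ← mulVec_mulVec, hZ, mulVec_smul, hZ, ← mulVec_mulVec, hP,
      mulVec_zero, add_zero, smul_smul, ← add_smul]
    congr 1; ring
  rw [mulVec_mulVec, h.su2Casimir_mul_M_pow, ← mulVec_mulVec, hC, mulVec_smul]

end HighestWeight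

/-! ### The theorem -/

section Main

variable (E : Finset Λ) (cell : Λ → Finset Λ) (t lam U : ℝ)

/-- Membership in the ground multiplet `ker(H - e) ∩ {N̂ = N}`. [folklore] -/
private theorem mem_groundKer_iff (N : ℕ) (e : ℝ) (ψ : Fock (Orb Λ)) :
    ψ ∈ LinearMap.ker (Matrix.toLin' (hamiltonian E cell t lam U - ((e : ℝ) : ℂ) • 1)) ⊓
        LinearMap.ker (Matrix.toLin' (totalNumber - (N : ℂ) • (1 : Matrix _ _ ℂ))) ↔
      hamiltonian E cell t lam U *ᵥ ψ = (e : ℂ) • ψ ∧ IsNParticle N ψ := by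
  rw [Submodule.mem_inf, LinearMap.mem_ker, LinearMap.mem_ker, Matrix.toLin'_apply, Matrix.toLin'_apply,
    sub_mulVec, sub_mulVec, smul_mulVec, smul_mulVec, one_mulVec, sub_eq_zero, sub_eq_zero,
    LiebTwo.isNParticle_iff_totalNumber]

/-- A vector of one sector vanishes outside it (evaluation form). [folklore] -/
private theorem apply_eq_zero_of_isInSector_of_ne {a b : ℕ} {φ : Fock (Orb Λ)} (hφ : IsInSector a b φ)
    {s : Finset (Orb Λ)} (hs : (upPart s).card ≠ a ∨ (downPart s).card ≠ b) : φ s = 0 :=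
  hφ s fun h => hs.elim (fun h' => h' h.1) fun h' => h' h.2

variable {t lam U}

/-- **Flat-band ferromagnetism** [Tasaki 1998, Theorem 6.1; Tasaki 1992]. For the Hubbard model of the
cell construction with `t > 0`, `λ ≠ 0`, `U > 0`, external sites connected through the cells, and
electron number `N_e = |E|`: the ground-state energy of the `N_e`-sector is `0`; every ground state
`ψ` has total spin `S = N_e/2`, `S² ψ = (N_e/2)(N_e/2 + 1) ψ`; and the ground eigenspace of the
`N_e`-particle sector has dimension exactly `N_e + 1` (the ground states are "non-degenerate apart
from the trivial `(2 S_max + 1)`-fold degeneracy"). [cite: Tasaki1998PTP, §6.1, Theorem 6.1]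
[cite: Tasaki1992, Theorem] -/
theorem flatBand_ferromagnetism (hcell : ∀ i, i ∉ E → cell i ⊆ E)
    (hconn : (cellGraph E cell).Preconnected) (ht : 0 < t) (hlam : lam ≠ 0) (hU : 0 < U) :
    groundEnergy (hamiltonian E cell t lam U) E.card = 0 ∧
      (∀ ψ : Fock (Orb Λ), IsGroundState (hamiltonian E cell t lam U) E.card ψ →
        spinSq *ᵥ ψ = ((((E.card : ℝ) / 2) * ((E.card : ℝ) / 2 + 1) : ℝ) : ℂ) • ψ) ∧
      Module.finrank ℂ ↥(LinearMap.ker (Matrix.toLin' (hamiltonian E cell t lam U -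
          ((groundEnergy (hamiltonian E cell t lam U) E.card : ℝ) : ℂ) • 1)) ⊓
        LinearMap.ker (Matrix.toLin' (totalNumber - (E.card : ℂ) • (1 : Matrix (Finset (Orb Λ)) _ ℂ)))) =
        E.card + 1 := by
  classical
  set H := hamiltonian E cell t lam U with hH
  set N := E.card with hN
  -- the ferromagnetic zero-energy state
  obtain ⟨hwS, hwG, hwK, hw0⟩ := ferroState_spec (E := E) (cell := cell) (lam := lam) hcell hlam
  set w := ferroState E cell lam with hw
  have hwN : IsNParticle N w := by simpa using hwS.isNParticle
  have hker : ∀ φ : Fock (Orb Λ), H *ᵥ φ = 0 ↔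
      (∀ i, i ∉ E → ∀ σ : Fin 2, fieldAnn (cellVec cell lam i) σ *ᵥ φ = 0) ∧ IsGutzwiller φ := by
    intro φ
    rw [hH, hamiltonian_mulVec_eq_zero_iff E cell lam ht hU]
    simp only [Finset.mem_compl]
  have hwH : H *ᵥ w = 0 := (hker w).2 ⟨hwK, hwG⟩
  have hE0 : groundEnergy H N = 0 := groundEnergy_hamiltonian_eq_zero E cell lam ht.le hU.le hwN hw0 hwH
  -- the spin triple and the lowering string
  have h3 := LiebTwo.isSu2Triple_spin (Λ := Λ)
  have hZw : HubbardWave0.spinZ *ᵥ w = ((N : ℂ) / 2) • w := by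
    rw [LiebThm1.spinZ_mulVec_of_isInSector hwS]; congr 1; push_cast; ring
  have hPw : spinPlus *ᵥ w = 0 := LiebThm1.raisesSpin_spinPlus.mulVec_eq_zero hwS
  set v : ℕ → Fock (Orb Λ) := fun k => spinMinus ^ k *ᵥ w with hv
  have hv_ne : ∀ k, k ≤ N → v k ≠ 0 := su2_lower_pow_ne_zero h3 hw0 hPw hZw
  have hv_spin : ∀ k, spinSq *ᵥ v k = (((N : ℂ) / 2) * ((N : ℂ) / 2 + 1)) • v k := fun k => by
    rw [← LiebTwo.su2Casimir_spin_eq_spinSq]; exact su2Casimir_lower_pow h3 hPw hZw k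
  have hv_H : ∀ k, H *ᵥ v k = 0 := fun k => by
    simp only [hv]
    rw [mulVec_mulVec, ((commute_hamiltonian_spinMinus E cell t lam U).pow_right k).eq, ← mulVec_mulVec, hwH,
      mulVec_zero]
  have hcN : Commute (totalNumber : Matrix (Finset (Orb Λ)) (Finset (Orb Λ)) ℂ) spinMinus := by
    unfold Commute SemiconjBy; exact LiebTwo.totalNumber_mul_spinMinus
  have hv_N : ∀ k, IsNParticle N (v k) := fun k =>
    LiebTwo.isNParticle_mulVec_of_commute hwN (hcN.pow_right k).eq
  have hv_sector : ∀ k, k ≤ N → IsInSector (N - k) k (v k) := by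
    intro k
    induction k with
    | zero => intro _; simpa [hv] using hwS
    | succ k ih =>
      intro hk
      have h' := LiebThm1.lowersSpin_spinMinus.isInSector_mulVec
        (show IsInSector (N - (k + 1) + 1) k (v k) by
          have := ih (Nat.le_of_succ_le hk); rwa [show N - k = N - (k + 1) + 1 by omega] at this)
      simp only [hv, pow_succ', ← mulVec_mulVec]
      exact h'
  -- every zero-energy `N`-particle vector lies in the span of the string
  have hspan : ∀ ψ : Fock (Orb Λ), H *ᵥ ψ = 0 → IsNParticle N ψ →
      ∃ c : ℕ → ℂ, ψ = ∑ a ∈ range (N + 1), c a • v (N - a) := by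
    intro ψ hψH hψN
    obtain ⟨hψK, hψG⟩ := (hker ψ).1 hψH
    have hcomp : ∀ a, a ≤ N → ∃ c : ℂ, sectorProj a (N - a) ψ = c • v (N - a) := by
      intro a ha
      have hPa : H *ᵥ sectorProj a (N - a) ψ = 0 := by
        rw [(preservesSectors_hamiltonian E cell t lam U).mulVec_sectorProj, hψH]
        funext s; simp [sectorProj_apply]
      obtain ⟨hKa, hGa⟩ := (hker _).1 hPa
      have hSv : IsInSector a (N - a) (v (N - a)) := by
        have := hv_sector (N - a) (Nat.sub_le _ _); rwa [Nat.sub_sub_self ha] at this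
      exact exists_smul_of_sector hcell hlam hconn hKa hGa (isInSector_sectorProj _ _ _)
        ((hker _).1 (hv_H _)).1 ((hker _).1 (hv_H _)).2 hSv (hv_ne _ (Nat.sub_le _ _)) ha
    choose! c hc using hcomp
    refine ⟨c, ?_⟩
    conv_lhs => rw [← sum_sectorProj_eq hψN]
    exact sum_congr rfl fun a ha => hc a (Nat.lt_succ_iff.1 (mem_range.1 ha))
  refine ⟨hE0, fun ψ hψ => ?_, ?_⟩
  · -- total spin of a ground state
    rw [isGroundState_iff_of_groundEnergy_eq_zero E cell lam hE0] at hψ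
    obtain ⟨hψN, -, hψH⟩ := hψ
    obtain ⟨c, hc⟩ := hspan ψ hψH hψN
    have hcast : ((((E.card : ℝ) / 2) * ((E.card : ℝ) / 2 + 1) : ℝ) : ℂ) = ((N : ℂ) / 2) * ((N : ℂ) / 2 + 1) := by
      push_cast; ring
    rw [hcast, hc, mulVec_sum, Finset.smul_sum]
    refine sum_congr rfl fun a _ => ?_
    rw [mulVec_smul, hv_spin, smul_comm]
  · -- dimension of the ground multiplet
    rw [hE0]
    set V := LinearMap.ker (Matrix.toLin' (H - ((0 : ℝ) : ℂ) • 1)) ⊓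
      LinearMap.ker (Matrix.toLin' (totalNumber - (N : ℂ) • (1 : Matrix (Finset (Orb Λ)) _ ℂ))) with hVdef
    have hmem : ∀ ψ, ψ ∈ V ↔ H *ᵥ ψ = 0 ∧ IsNParticle N ψ := fun ψ => by
      rw [hVdef, mem_groundKer_iff, Complex.ofReal_zero, zero_smul]
    set b : Fin (N + 1) → Fock (Orb Λ) := fun k => v k with hb
    have hli : LinearIndependent ℂ b := by
      rw [linearIndependent_iff']
      intro S g hg k hk
      -- evaluate at a configuration in the sector of `v k` where it does not vanish
      have hvk := hv_ne k (Nat.lt_succ_iff.1 k.2)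
      obtain ⟨s, hs⟩ : ∃ s, v k s ≠ 0 := by
        by_contra h'; push Not at h'; exact hvk (funext h')
      have hsec : (upPart s).card = N - k ∧ (downPart s).card = k := by
        by_contra h'; exact hs (hv_sector k (Nat.lt_succ_iff.1 k.2) s h')
      have heval := congrFun hg s
      rw [Finset.sum_apply, Pi.zero_apply, Finset.sum_eq_single k] at heval
      · rw [Pi.smul_apply, smul_eq_mul] at heval
        exact (mul_eq_zero.1 heval).resolve_right hs
      · intro k' _ hk'
        rw [Pi.smul_apply, smul_eq_mul]
        change g k' * v k' s = 0
        have hne : (k' : ℕ) ≠ k := fun h => hk' (Fin.ext h)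
        rw [apply_eq_zero_of_isInSector_of_ne (hv_sector k' (Nat.lt_succ_iff.1 k'.2))
          (Or.inr (by rw [hsec.2]; exact fun h => hne h.symm)), mul_zero]
      · intro h; exact absurd hk h
    have hspanV : Submodule.span ℂ (Set.range b) = V := by
      apply le_antisymm
      · rw [Submodule.span_le]
        rintro _ ⟨k, rfl⟩
        exact (hmem _).2 ⟨hv_H k, hv_N k⟩
      · intro ψ hψ
        obtain ⟨hψH, hψN⟩ := (hmem ψ).1 hψ
        obtain ⟨c, hc⟩ := hspan ψ hψH hψN
        rw [hc]
        refine Submodule.sum_mem _ fun a ha => Submodule.smul_mem _ _ (Submodule.subset_span ?_)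
        have haN : N - a < N + 1 := by omega
        exact ⟨⟨N - a, haN⟩, rfl⟩
    rw [← hspanV, finrank_span_eq_card hli, Fintype.card_fin]

end Main

/-! ### Corollary: the long-range hopping model with uniform weights (Tasaki 1998, Theorem 5.1) -/

section LongRange

variable (t lam U : ℝ)

/-- The long-range hopping model of [Tasaki 1998, §5.1] with the site weights `λ_{x₀} = λ`,
`λ_x = 1` (`x ≠ x₀`): `t_{xy} = t λ_x λ_y` for ALL pairs `x, y`, `H = Σ t_{xy} c†_{xσ} c_{yσ} +
U Σ n_{x↑} n_{x↓}`, realised as the cell construction with the single internal site `x₀` and the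
single cell `Λ ∖ {x₀}` ("it is possible to assemble many (identical) copies of the long-range model",
§6.1). The printed general form (arbitrary site weights `λ_x`, all `≠ 0`) is
`tasaki_longRange_ferromagnetism` in `FlatBandFerromagnetismMielke.lean` (`T = t|λ⟩⟨λ|` as the Gram
Hamiltonian of `{λ}`; this uniform-weight family is its special case
`longRangeHamiltonian_eq_tasakiLongRangeHamiltonian`).
[cite: Tasaki1998PTP, §5.1 (hopping `t_{x,y} = t λ_x λ_y`, first display)] -/
def longRangeHamiltonian (x₀ : Λ) : Matrix (Finset (Orb Λ)) (Finset (Orb Λ)) ℂ :=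
  hamiltonian (univ.erase x₀) (fun _ => univ.erase x₀) t lam U

/-- The hopping matrix of the uniform-weight long-range model is `t λ_x λ_y` with `λ_{x₀} = λ` and
`λ_x = 1` otherwise. [cite: Tasaki1998PTP, §5.1 (hopping `t_{x,y} = t λ_x λ_y`)] -/
theorem cellHopping_longRange (x₀ x y : Λ) :
    cellHopping (univ.erase x₀) (fun _ => univ.erase x₀) t lam x y =
      t * ((if x = x₀ then lam else 1) * (if y = x₀ then lam else 1)) := by
  have hc : (univ.erase x₀ : Finset Λ)ᶜ = {x₀} := by
    ext z
    simp
  have hv : ∀ z, cellVec (fun _ => univ.erase x₀) lam x₀ z = if z = x₀ then lam else 1 := by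
    intro z
    by_cases hz : z = x₀
    · rw [hz, cellVec_self, if_pos rfl]
    · rw [cellVec_of_ne _ _ hz, if_neg hz, if_pos (mem_erase.2 ⟨hz, mem_univ z⟩)]
  simp only [cellHopping, hc, sum_singleton, hv]

/-- In the single-cell model any two distinct external sites lie in the common cell, so the cell
graph is connected ("an electron can hop from any site in the lattice to any other site").
[cite: Tasaki1998PTP, §5.1] -/
theorem cellGraph_longRange_preconnected (x₀ : Λ) :
    (cellGraph (univ.erase x₀) (fun _ => univ.erase x₀)).Preconnected := by
  intro y z
  by_cases h : y = z
  · rw [h]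
  · refine SimpleGraph.Adj.reachable ?_
    rw [cellGraph_adj_iff]
    exact ⟨h, x₀, by simp, y.2, z.2⟩

variable {t lam U}

/-- **Ferromagnetism in the long-range hopping model** [Tasaki 1998, Theorem 5.1], uniform-weight
family (`λ_{x₀} = λ ≠ 0`, `λ_x = 1` otherwise): with `N_e = |Λ ∖ {x₀}| = |Λ| - 1` electrons and any
`t > 0`, `U > 0`, the ground-state energy is `0`, every ground state has total spin
`S = S_max = N_e/2` (`S² ψ = S_max(S_max + 1) ψ`), and the ground states are non-degenerate apart from
the trivial `(2 S_max + 1)`-fold degeneracy (ground multiplet of dimension exactly `N_e + 1`).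
Obtained from `flatBand_ferromagnetism` with one cell; the printed theorem with arbitrary weights
`λ_x` is `tasaki_longRange_ferromagnetism` (`FlatBandFerromagnetismMielke.lean`).
[cite: Tasaki1998PTP, §5.1, Theorem 5.1] -/
theorem longRange_ferromagnetism (x₀ : Λ) (ht : 0 < t) (hlam : lam ≠ 0) (hU : 0 < U) :
    groundEnergy (longRangeHamiltonian t lam U x₀) (univ.erase x₀).card = 0 ∧
      (∀ ψ : Fock (Orb Λ), IsGroundState (longRangeHamiltonian t lam U x₀) (univ.erase x₀).card ψ →
        spinSq *ᵥ ψ =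
          (((((univ.erase x₀).card : ℝ) / 2) * (((univ.erase x₀).card : ℝ) / 2 + 1) : ℝ) : ℂ) • ψ) ∧
      Module.finrank ℂ ↥(LinearMap.ker (Matrix.toLin' (longRangeHamiltonian t lam U x₀ -
          ((groundEnergy (longRangeHamiltonian t lam U x₀) (univ.erase x₀).card : ℝ) : ℂ) • 1)) ⊓
        LinearMap.ker (Matrix.toLin'
          (totalNumber - ((univ.erase x₀).card : ℂ) • (1 : Matrix (Finset (Orb Λ)) _ ℂ)))) =
        (univ.erase x₀).card + 1 :=
  flatBand_ferromagnetism (univ.erase x₀) (fun _ => univ.erase x₀) (fun _ _ => subset_rfl)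
    (cellGraph_longRange_preconnected x₀) ht hlam hU

end LongRange

end FlatBand

end Literature.MathematicalPhysics.QuantumLattice
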